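import Mathlib.Analysis.SpecialFunctions.Exp
import Mathlib.Analysis.SpecialFunctions.Log.Basic
import Mathlib.Analysis.SpecialFunctions.Pow.Real
import Mathlib.Analysis.SpecialFunctions.Sqrt
import Mathlib.Algebra.CharP.Defs
import Mathlib.Algebra.CharP.Basic
import Mathlib.FieldTheory.Finite.Basic
import Mathlib.Data.Nat.Choose.Lucas
import Mathlib.Data.Nat.Choose.Central
import Mathlib.Algebra.Order.Field.GeomSum
import Mathlib.Analysis.Complex.ExponentialBounds
import Mathlib.GroupTheory.Perm.Basic
import Mathlib.Data.Fintype.Perm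
import Mathlib.Data.Fintype.BigOperators
import Literature.Computability.MetaComplexity.SmolenskyProperty
import Literature.Computability.MetaComplexity.SmolenskyCorrelationRestrict
import Literature.Computability.MetaComplexity.LowDegreeClosure
import Literature.Computability.MetaComplexity.FpLinearSystemsProofs
import HarnessLib

/-!
# Srinivasan's robust version of Hegedűs's lemma (named fact) and the Hamming layers of the cube

Hegedűs's lemma (Hegedűs 2009; Srinivasan 2023, Lemma 1.1): over a field of characteristic `p`,
a polynomial vanishing on the Hamming layer `{0,1}ⁿ_k` but not at some point of the layer
`{0,1}ⁿ_{k+q}`, `q` a power of `p`, `k ∈ [q, n − q]`, has degree `≥ q`. (An elementary special case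
is proved in the tree: `Literature.Barriers.ValiantsHypothesis.FullRankMultilinearUnbalancing`,
`eval_indVec_eq_zero_of_layer`.) Srinivasan's ROBUST version (TheoretiCS 2 (2023), art. 5 =
STOC 2020, Lemma 3.1) replaces "vanishes on layer `k`" by "vanishes on all but an exponentially
small fraction of layer `k`" and "non-zero somewhere on layer `K = k ± q`" by "non-zero on a not
too small fraction of layer `K`", and still concludes `deg P = Ω(q)`.

This file vendors Lemma 3.1 as a NAMED FACT `Srinivasan2023_robustHegedus` (its printed proof,
§3 of the paper, pp. 11–17, combines a Smolensky-style dimension argument with the Nie–Wang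
bound on closures of subsets of Hamming layers — not yet in the tree), in the tree's vocabulary:
a polynomial `P ∈ F[x₁,…,xₙ]` of degree `≤ d` restricted to `{0,1}ⁿ` is exactly an element of
`Smolensky.lowDeg F n d` (multilinear polynomial functions of degree `≤ d`, `SmolenskyProperty.lean`),
so "`deg P = Ω(q)`" becomes "`P ∈ lowDeg F n d` ⇒ `c_H·q ≤ d`"; the layer probabilities
`Pr_{a ∼ {0,1}ⁿ_m}[P(a) ≠ 0]` become `nzFrac P m` (`layer`, `nzFrac` below, with `card_layer`);
`α = min{k/n, 1 − k/n}` is `alphaOf n k` and `δ²n/α = q²/(n·α)`. "`n` a growing parameter … `Ω(·)`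
hides an absolute constant" is read as `∃ c_H > 0, ∃ n₀, ∀ n ≥ n₀`, uniformly in `p`, `F`, `k`, `q`
(weaker than any uniform-in-`n` reading, hence safe as a hypothesis). `robustHegedus_F2` is the
`F = 𝔽₂` specialisation in exactly the shape requested by the QuantumAdvantage cell qa-qnc0
(planner file `Sketch2.lean`, `RobustHegedusF2`).

The fact is now PROVED in this file: `Srinivasan2023_robustHegedus_holds` (section `Proof` at
the end, following the printed proof with the Nie–Wang closure bound of `LowDegreeClosure.lean`;
absolute constant `c_H = 1/3000`, `n₀ = 0`), so downstream users can feed `(h : …)` with it.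

## References

* S. Srinivasan, *A robust version of Hegedűs's lemma, with applications*, TheoretiCS 2 (2023),
  article 5 (STOC 2020), Lemma 1.1 (Hegedűs), Lemma 3.1 (main lemma), Lemma 3.2, Remark 3.3,
  §3.3 (tightness) [Srinivasan2023].
* G. Hegedűs, *Balancing sets of vectors*, Studia Sci. Math. Hungar. 47 (2010), 333–349.
-/

noncomputable section

namespace Literature.Computability.MetaComplexity

namespace Hegedus

open Finset Smolensky

variable {n : ℕ}

/-! ### Hamming layers of the cube -/

/-- The Hamming weight `|u| = #{i : uᵢ = 1}` of a point of the cube. [cite: Srinivasan2023, §1 (the layers {0,1}ⁿ_m)] -/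
def wt (u : Fin n → Bool) : ℕ := (univ.filter fun i : Fin n => u i = true).card

/-- The Hamming layer `{0,1}ⁿ_m = {u : |u| = m}` ("the elements of `{0,1}ⁿ` of Hamming weight
exactly `m`"). [cite: Srinivasan2023, §1 (the layers {0,1}ⁿ_m)] -/
def layer (n m : ℕ) : Finset (Fin n → Bool) := univ.filter fun u => wt u = m

/-- `|{0,1}ⁿ_m| = C(n, m)` (the layer is in bijection with the `m`-subsets of the coordinates via
the support map). [cite: Srinivasan2023, §1 (the layers {0,1}ⁿ_m)] -/
theorem card_layer (n m : ℕ) : (layer n m).card = n.choose m := by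
  classical
  rw [show n.choose m = ((univ : Finset (Fin n)).powersetCard m).card by
    rw [Finset.card_powersetCard, Finset.card_univ, Fintype.card_fin]]
  refine Finset.card_bij (fun u _ => univ.filter fun i : Fin n => u i = true) (fun u hu => ?_)
    (fun u hu v hv h => ?_) (fun S hS => ?_)
  · rw [Finset.mem_powersetCard]
    exact ⟨Finset.filter_subset _ _, (Finset.mem_filter.1 hu).2⟩
  · funext i
    have := congrArg (fun T : Finset (Fin n) => decide (i ∈ T)) h
    simp only [Finset.mem_filter, Finset.mem_univ, true_and, Bool.decide_coe] at this
    cases hui : u i <;> cases hvi : v i <;> simp_all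
  · refine ⟨fun i => decide (i ∈ S), ?_, ?_⟩
    · rw [layer, Finset.mem_filter, wt]
      refine ⟨Finset.mem_univ _, ?_⟩
      rw [← (Finset.mem_powersetCard.1 hS).2]
      congr 1
      ext i
      simp
    · ext i
      simp

/-- The fraction of the layer `{0,1}ⁿ_m` on which `P` does NOT vanish:
`ψ = Pr_{a ∼ {0,1}ⁿ_m}[P(a) ≠ 0]` (`0` on an empty layer). [cite: Srinivasan2023, Lemma 3.1 (hypotheses (1a), (1b))] -/
def nzFrac {F : Type*} [Field F] [DecidableEq F] (P : CubeFn F n) (m : ℕ) : ℝ :=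
  (((layer n m).filter fun u => P u ≠ 0).card : ℝ) / (n.choose m : ℝ)

/-- `0 ≤ ψ`. [cite: Srinivasan2023, Lemma 3.1 (hypotheses (1a), (1b))] -/
theorem nzFrac_nonneg {F : Type*} [Field F] [DecidableEq F] (P : CubeFn F n) (m : ℕ) :
    0 ≤ nzFrac P m :=
  div_nonneg (Nat.cast_nonneg _) (Nat.cast_nonneg _)

/-- `ψ ≤ 1`. [cite: Srinivasan2023, Lemma 3.1 (hypotheses (1a), (1b))] -/
theorem nzFrac_le_one {F : Type*} [Field F] [DecidableEq F] (P : CubeFn F n) (m : ℕ) :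
    nzFrac P m ≤ 1 := by
  unfold nzFrac
  rcases Nat.eq_zero_or_pos (n.choose m) with h | h
  · rw [h, Nat.cast_zero, div_zero]; exact zero_le_one
  · rw [div_le_one (by exact_mod_cast h), ← card_layer]
    exact_mod_cast Finset.card_filter_le _ _

/-- `α = min{k/n, 1 − k/n}` of Lemma 3.1. [cite: Srinivasan2023, Lemma 3.1] -/
def alphaOf (n k : ℕ) : ℝ := min ((k : ℝ) / n) (1 - (k : ℝ) / n)

/-! ### The named fact -/

/-- **Srinivasan's robust Hegedűs lemma** (Srinivasan 2023, Lemma 3.1, verbatim): "Assume that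
`F` is a field of characteristic `p`. Let `n` be a growing parameter and assume we have positive
integer parameters `k, q` such that `100q < k < n − 100q` and `q` is a power of `p`. Define
`α = min{k/n, 1 − (k/n)}` and `δ = q/n`. Assume `P ∈ F[x₁,…,xₙ]` is a polynomial such that for
some `K ∈ {k + q, k − q}`,
(1a) `Pr_{a ∼ {0,1}ⁿ_k}[P(a) ≠ 0] ≤ min{e^{−100δ²n/α}, 1/1000}`,
(1b) `Pr_{a ∼ {0,1}ⁿ_K}[P(a) ≠ 0] ≥ e^{−δ²n/(100α)}`.
Then `deg(P) = Ω(q)`, where the `Ω(·)` hides an absolute constant."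
Here: `δ²n/α = q²/(n·α)`; the restriction of `P` to the cube is an element of `lowDeg F n d` for
`d = deg P` and every element of `lowDeg F n d` arises so, whence the form "`P ∈ lowDeg F n d` ⇒
`c_H·q ≤ d`"; "growing `n`, absolute `Ω`" is read as `∃ c_H > 0, ∃ n₀` uniform in everything else.
NOT proved here (the printed proof uses the Nie–Wang closure bound for Hamming layers).
[cite: Srinivasan2023, Lemma 3.1] -/
def Srinivasan2023_robustHegedus : Prop :=
  ∃ cH : ℝ, 0 < cH ∧ ∃ n₀ : ℕ,
    ∀ (p : ℕ) [Fact p.Prime] (F : Type) [Field F] [CharP F p] [DecidableEq F] (n : ℕ), n₀ ≤ n →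
      ∀ k q d : ℕ, (∃ j : ℕ, q = p ^ j) → 100 * q < k → k + 100 * q < n →
        ∀ P : CubeFn F n, P ∈ lowDeg F n d →
          nzFrac P k ≤ min (Real.exp (-(100 * (q : ℝ) ^ 2 / (n * alphaOf n k)))) (1 / 1000) →
          (Real.exp (-((q : ℝ) ^ 2 / (100 * n * alphaOf n k))) ≤ nzFrac P (k + q) ∨
            Real.exp (-((q : ℝ) ^ 2 / (100 * n * alphaOf n k))) ≤ nzFrac P (k - q)) →
          cH * q ≤ d

/-- **The case `F = 𝔽₂`, `q` a power of `2`** (the shape `RobustHegedusF2` consumed by the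
QuantumAdvantage cell qa-qnc0: an `𝔽₂`-polynomial of degree `< c_H·q` that vanishes on all but an
`min{e^{−100q²/(nα)}, 1/1000}` fraction of layer `k` is non-zero on less than an `e^{−q²/(100nα)}`
fraction of BOTH layers `k ± q`). [cite: Srinivasan2023, Lemma 3.1 (p = 2)] -/
theorem robustHegedus_F2 (h : Srinivasan2023_robustHegedus) :
    ∃ cH : ℝ, 0 < cH ∧ ∃ n₀ : ℕ, ∀ n : ℕ, n₀ ≤ n → ∀ k q d : ℕ, (∃ j : ℕ, q = 2 ^ j) →
      100 * q < k → k + 100 * q < n →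
      ∀ P : CubeFn (ZMod 2) n, P ∈ lowDeg (ZMod 2) n d →
        nzFrac P k ≤ min (Real.exp (-(100 * (q : ℝ) ^ 2 / (n * alphaOf n k)))) (1 / 1000) →
        (Real.exp (-((q : ℝ) ^ 2 / (100 * n * alphaOf n k))) ≤ nzFrac P (k + q) ∨
          Real.exp (-((q : ℝ) ^ 2 / (100 * n * alphaOf n k))) ≤ nzFrac P (k - q)) →
        cH * q ≤ d := by
  obtain ⟨cH, hc, n₀, h⟩ := h
  exact ⟨cH, hc, n₀, fun n hn k q d hq h1 h2 P hP ha hb => h 2 (ZMod 2) n hn k q d hq h1 h2 P hP ha hb⟩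

/-- Contrapositive reading used downstream: a low-degree polynomial (`d < c_H·q`) that is
exponentially rarely non-zero on layer `k` is non-zero on less than an `e^{−q²/(100nα)}` fraction
of layer `k + q` AND of layer `k − q`. [cite: Srinivasan2023, Lemma 3.1] -/
theorem Srinivasan2023_robustHegedus.nzFrac_lt (h : Srinivasan2023_robustHegedus) :
    ∃ cH : ℝ, 0 < cH ∧ ∃ n₀ : ℕ,
      ∀ (p : ℕ) [Fact p.Prime] (F : Type) [Field F] [CharP F p] [DecidableEq F] (n : ℕ), n₀ ≤ n →
        ∀ k q d : ℕ, (∃ j : ℕ, q = p ^ j) → 100 * q < k → k + 100 * q < n → (d : ℝ) < cH * q →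
          ∀ P : CubeFn F n, P ∈ lowDeg F n d →
            nzFrac P k ≤ min (Real.exp (-(100 * (q : ℝ) ^ 2 / (n * alphaOf n k)))) (1 / 1000) →
            nzFrac P (k + q) < Real.exp (-((q : ℝ) ^ 2 / (100 * n * alphaOf n k))) ∧
              nzFrac P (k - q) < Real.exp (-((q : ℝ) ^ 2 / (100 * n * alphaOf n k))) := by
  obtain ⟨cH, hc, n₀, h⟩ := h
  refine ⟨cH, hc, n₀, fun p _ F _ _ _ n hn k q d hq h1 h2 hd P hP ha => ?_⟩
  by_contra hcon
  rw [not_and_or, not_lt, not_lt] at hcon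
  have := h p F n hn k q d hq h1 h2 P hP ha hcon
  linarith


/-! ## Proof of Lemma 3.1 (discharge of `Srinivasan2023_robustHegedus`)

We follow Srinivasan's proof (§3, pp. 11–17) with our own (cruder) absolute constants:

* **Claim 3.8** — `lucasPoly`: for `t = p^ℓ` the symmetric polynomial
  `Π_{i<ℓ} (1 - (e_{p^i} - m_i)^{p-1})` (`e_s` the elementary symmetric functions, `m_i` the
  base-`p` digits of `m`) has degree `≤ t - 1` and is non-zero exactly on the Hamming weights
  `≡ m (mod t)` (Lucas's theorem `C(w, p^i) ≡ w_i (mod p)` and Fermat's little theorem);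
* **Lemma 3.5** — `choose_ratio_upper` / `choose_ratio_lower`: ratios of binomial coefficients
  `C(2m, m-s)/C(2m, m-r)`, and `four_pow_le_sqrt_mul_centralBinom`: `4^m ≤ 2√m·C(2m,m)`;
* **Lemma 3.2 / Claim 3.9** — `special_case` (counting form): with `Q₂` from the Nie–Wang closure
  bound (`LowDegreeClosure.lean`, Theorem 3.6) and Fact 3.4, `deg ≥ t/50`;
* **Lemma 3.10 and the restriction step** — `ampRestrict` (a product of `r` randomly permuted
  copies of `P` restricted to a centred subcube), `sum_nzFrac_ampRestrict` (its layer densities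
  average to `ψ_k(P)^r`, by double counting over the symmetric group) and `exists_le_and_lt`
  (Markov); `cpl` (negating all inputs, Remark 3.3) reduces `K = k - q` to `K = k + q`;
* **Lemma 3.1** — `Srinivasan2023_robustHegedus_holds`, with `c_H = 1/3000`: small `q` is free
  (a degree-`0` polynomial cannot satisfy (1a) and (1b)), and for `q > 3000` we restrict to a
  subcube of dimension `2m` with `m = min(k,n-k)/10` (when `q² ≥ 2 min(k,n-k)`, no
  amplification) or `m = q²/200` with `r = 35`-fold amplification (otherwise), then apply
  `special_case` with `t = q`.
-/

section Proof

variable {F : Type*} [Field F]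

/-- [cite: Srinivasan2023, §1 (the layers {0,1}ⁿ_m)] -/
theorem mem_layer_iff {m : ℕ} {u : Fin n → Bool} : u ∈ layer n m ↔ wt u = m := by
  simp [layer]

/-! ### Elementary symmetric functions on the cube and Lucas's theorem -/

/-- The elementary symmetric function `e_s = Σ_{|S| = s} x_S` on the cube.
[cite: Srinivasan2023, Corollary 2.9 (proof: an elementary symmetric polynomial evaluates to a binomial coefficient of the Hamming weight)] -/
def esymm (F : Type*) [Field F] (n s : ℕ) : CubeFn F n :=
  ∑ S ∈ powersetCard s (univ : Finset (Fin n)), mono F S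

/-- [cite: Srinivasan2023, Corollary 2.9 (proof: an elementary symmetric polynomial evaluates to a binomial coefficient of the Hamming weight)] -/
theorem esymm_mem_lowDeg (s : ℕ) : esymm F n s ∈ lowDeg F n s := by
  unfold esymm
  refine Submodule.sum_mem _ fun S hS => mono_mem_lowDeg ?_
  exact (Finset.mem_powersetCard.1 hS).2.le

/-- `e_s(u) = C(|u|, s)`.
[cite: Srinivasan2023, Corollary 2.9 (proof: an elementary symmetric polynomial evaluates to a binomial coefficient of the Hamming weight)] -/
theorem esymm_apply (s : ℕ) (u : Fin n → Bool) : esymm F n s u = ((wt u).choose s : F) := by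
  unfold esymm wt
  set A : Finset (Fin n) := univ.filter fun i => u i = true with hA
  rw [Finset.sum_apply]
  have h1 : ∀ S ∈ powersetCard s (univ : Finset (Fin n)),
      mono F S u = if S ⊆ A then 1 else 0 := by
    intro S _
    rw [mono_apply]
    have : (∀ i ∈ S, u i = true) ↔ S ⊆ A := by
      simp only [hA, Finset.subset_iff, Finset.mem_filter, Finset.mem_univ, true_and]
    by_cases h : ∀ i ∈ S, u i = true
    · rw [if_pos h, if_pos (this.1 h)]
    · rw [if_neg h, if_neg fun h' => h (this.2 h')]
  rw [Finset.sum_congr rfl h1, Finset.sum_boole, ← Finset.card_powersetCard s A]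
  congr 2
  ext S
  simp only [Finset.mem_filter, Finset.mem_powersetCard, Finset.subset_univ, true_and]
  tauto

/-- Lucas: `C(w, p^i) ≡ ⌊w/p^i⌋ (mod p)`.
[cite: Srinivasan2023, Theorem 2.8 (Lucas's theorem)] -/
theorem choose_prime_pow_modEq (p : ℕ) [hp : Fact p.Prime] (i w : ℕ) :
    w.choose (p ^ i) ≡ w / p ^ i [MOD p] := by
  induction i generalizing w with
  | zero => simp [Nat.ModEq.refl]
  | succ i ih =>
    have h := Choose.choose_modEq_choose_mod_mul_choose_div_nat (n := w) (k := p ^ (i + 1)) (p := p)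
    have hp0 : 0 < p := hp.out.pos
    rw [pow_succ, Nat.mul_mod_left, Nat.choose_zero_right, one_mul, Nat.mul_div_cancel _ hp0] at h
    refine h.trans ?_
    rw [pow_succ', ← Nat.div_div_eq_div_mul]
    exact ih (w / p)

/-- In characteristic `p`: `(C(w, p^i) : F) = (digit_i(w) : F)`.
[cite: Srinivasan2023, Theorem 2.8 (Lucas's theorem)] -/
theorem cast_choose_prime_pow (p : ℕ) [Fact p.Prime] [CharP F p] (i w : ℕ) :
    ((w.choose (p ^ i) : ℕ) : F) = ((w / p ^ i % p : ℕ) : F) :=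
  CharP.natCast_eq_natCast' F p (((choose_prime_pow_modEq p i w)).trans (Nat.mod_modEq _ _).symm)

/-- Fermat in the prime field of `F`: for `a ≠ b` below `p`, `((a:F) - b)^{p-1} = 1`. [folklore] -/
private theorem sub_natCast_pow_eq_one (p : ℕ) [hp : Fact p.Prime] [CharP F p] {a b : ℕ} (ha : a < p)
    (hb : b < p) (hab : a ≠ b) : ((a : F) - (b : F)) ^ (p - 1) = 1 := by
  set z : ZMod p := (a : ZMod p) - (b : ZMod p) with hz
  have hz0 : z ≠ 0 := by
    intro h
    rw [hz, sub_eq_zero, ZMod.natCast_eq_natCast_iff] at h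
    exact hab (Nat.ModEq.eq_of_lt_of_lt h ha hb)
  have hzp : z ^ (p - 1) = 1 := ZMod.pow_card_sub_one_eq_one hz0
  have hmap : (ZMod.castHom (dvd_refl p) F) z = (a : F) - (b : F) := by
    rw [hz, map_sub, map_natCast, map_natCast]
  rw [← hmap, ← map_pow, hzp, map_one]

/-- Auxiliary. [folklore] -/
private theorem natCast_eq_natCast_iff_of_lt (p : ℕ) [Fact p.Prime] [CharP F p] {a b : ℕ} (ha : a < p)
    (hb : b < p) : ((a : F) = (b : F)) ↔ a = b := by
  constructor
  · intro h
    exact Nat.ModEq.eq_of_lt_of_lt ((CharP.natCast_eq_natCast F p).1 h) ha hb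
  · rintro rfl; rfl

/-- One Lucas factor: `1 - (e_{p^i} - digit_i(m))^{p-1}`.
[cite: Srinivasan2023, Claim 3.8 (the polynomial Q₁, via Lucas's theorem, Theorem 2.8)] -/
def digitFactor (F : Type*) [Field F] (n p i m : ℕ) : CubeFn F n :=
  1 - (esymm F n (p ^ i) - ((m / p ^ i % p : ℕ) : F) • (1 : CubeFn F n)) ^ (p - 1)

/-- [cite: Srinivasan2023, Claim 3.8 (the polynomial Q₁, via Lucas's theorem, Theorem 2.8)] -/
theorem digitFactor_mem_lowDeg (p : ℕ) [Fact p.Prime] (i m : ℕ) :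
    digitFactor F n p i m ∈ lowDeg F n ((p - 1) * p ^ i) := by
  unfold digitFactor
  refine Submodule.sub_mem _ (lowDeg_mono (Nat.zero_le _) (one_mem_lowDeg 0)) ?_
  refine pow_mem_lowDeg (Submodule.sub_mem _ (esymm_mem_lowDeg _) ?_) (p - 1)
  exact Submodule.smul_mem _ _ (lowDeg_mono (Nat.zero_le _) (one_mem_lowDeg 0))

/-- [cite: Srinivasan2023, Claim 3.8 (the polynomial Q₁, via Lucas's theorem, Theorem 2.8)] -/
theorem digitFactor_apply (p : ℕ) [hp : Fact p.Prime] [CharP F p] (i m : ℕ) (u : Fin n → Bool) :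
    digitFactor F n p i m u = if wt u / p ^ i % p = m / p ^ i % p then 1 else 0 := by
  have hp1 : 1 ≤ p - 1 := by have := hp.out.two_le; omega
  unfold digitFactor
  simp only [Pi.sub_apply, Pi.one_apply, Pi.pow_apply, Pi.smul_apply, smul_eq_mul, mul_one,
    esymm_apply, cast_choose_prime_pow p]
  have ha : wt u / p ^ i % p < p := Nat.mod_lt _ hp.out.pos
  have hb : m / p ^ i % p < p := Nat.mod_lt _ hp.out.pos
  by_cases h : wt u / p ^ i % p = m / p ^ i % p
  · rw [if_pos h, h, sub_self, zero_pow (by omega), sub_zero]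
  · rw [if_neg h, sub_natCast_pow_eq_one p ha hb h, sub_self]

/-- The Lucas polynomial `Q1 = Π_{i<ℓ} (1 - (e_{p^i} - m_i)^{p-1})`: non-zero exactly on the
weights `≡ m (mod p^ℓ)`, of degree `≤ p^ℓ - 1`.
[cite: Srinivasan2023, Claim 3.8 (the polynomial Q₁, via Lucas's theorem, Theorem 2.8)] -/
def lucasPoly (F : Type*) [Field F] (n p ℓ m : ℕ) : CubeFn F n :=
  ∏ i ∈ range ℓ, digitFactor F n p i m

/-- [cite: Srinivasan2023, Claim 3.8 (the polynomial Q₁, via Lucas's theorem, Theorem 2.8)] -/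
theorem lucasPoly_mem_lowDeg (p : ℕ) [hp : Fact p.Prime] (ℓ m : ℕ) :
    lucasPoly F n p ℓ m ∈ lowDeg F n (p ^ ℓ - 1) := by
  unfold lucasPoly
  induction ℓ with
  | zero =>
    rw [Finset.prod_range_zero]
    exact one_mem_lowDeg _
  | succ ℓ ih =>
    rw [Finset.prod_range_succ]
    have h := mul_mem_lowDeg_add ih (digitFactor_mem_lowDeg (F := F) (n := n) p ℓ m)
    refine lowDeg_mono ?_ h
    have h1 : 1 ≤ p ^ ℓ := Nat.one_le_pow _ _ hp.out.pos
    have h2 : p ^ (ℓ + 1) = p * p ^ ℓ := pow_succ' p ℓ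
    have h3 : 1 ≤ p := hp.out.pos
    have h4 : 1 ≤ p * p ^ ℓ := by rw [← h2]; exact Nat.one_le_pow _ _ hp.out.pos
    rw [h2]
    zify [h1, h3, h4]
    exact le_of_eq (by ring)

/-- Digits determine the residue: `(∀ i < ℓ, digit_i w = digit_i m) ↔ w ≡ m (mod p^ℓ)`. [folklore] -/
private theorem digits_eq_iff (p : ℕ) (hp : 0 < p) (ℓ w m : ℕ) :
    (∀ i < ℓ, w / p ^ i % p = m / p ^ i % p) ↔ w % p ^ ℓ = m % p ^ ℓ := by
  induction ℓ with
  | zero => simp [Nat.mod_one]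
  | succ ℓ ih =>
    rw [Nat.mod_pow_succ, Nat.mod_pow_succ]
    constructor
    · intro h
      rw [ih.1 fun i hi => h i (Nat.lt_succ_of_lt hi), h ℓ (Nat.lt_succ_self ℓ)]
    · intro h
      have hpl : 0 < p ^ ℓ := Nat.pow_pos hp
      have hw : w % p ^ ℓ < p ^ ℓ := Nat.mod_lt _ hpl
      have hm : m % p ^ ℓ < p ^ ℓ := Nat.mod_lt _ hpl
      -- uniqueness of the base-`p^ℓ` decomposition `a + p^ℓ b`
      have hdiv : w / p ^ ℓ % p = m / p ^ ℓ % p := by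
        have h1 : (w % p ^ ℓ + p ^ ℓ * (w / p ^ ℓ % p)) / p ^ ℓ =
            (m % p ^ ℓ + p ^ ℓ * (m / p ^ ℓ % p)) / p ^ ℓ := by rw [h]
        rwa [Nat.add_mul_div_left _ _ hpl, Nat.add_mul_div_left _ _ hpl, Nat.div_eq_of_lt hw,
          Nat.div_eq_of_lt hm, zero_add, zero_add] at h1
      have hmod : w % p ^ ℓ = m % p ^ ℓ := by
        have h1 : (w % p ^ ℓ + p ^ ℓ * (w / p ^ ℓ % p)) % p ^ ℓ =
            (m % p ^ ℓ + p ^ ℓ * (m / p ^ ℓ % p)) % p ^ ℓ := by rw [h]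
        rwa [Nat.add_mul_mod_self_left, Nat.add_mul_mod_self_left, Nat.mod_eq_of_lt hw,
          Nat.mod_eq_of_lt hm] at h1
      intro i hi
      rcases Nat.lt_succ_iff_lt_or_eq.1 hi with hi | rfl
      · exact (ih.2 hmod) i hi
      · exact hdiv

/-- [cite: Srinivasan2023, Claim 3.8 (the polynomial Q₁, via Lucas's theorem, Theorem 2.8)] -/
theorem lucasPoly_apply (p : ℕ) [hp : Fact p.Prime] [CharP F p] (ℓ m : ℕ) (u : Fin n → Bool) :
    lucasPoly F n p ℓ m u = if wt u % p ^ ℓ = m % p ^ ℓ then 1 else 0 := by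
  unfold lucasPoly
  rw [Finset.prod_apply]
  simp only [digitFactor_apply p]
  rw [Finset.prod_boole]
  have key : (∀ i ∈ range ℓ, wt u / p ^ i % p = m / p ^ i % p) ↔ wt u % p ^ ℓ = m % p ^ ℓ := by
    simp only [Finset.mem_range]
    exact digits_eq_iff p hp.out.pos ℓ (wt u) m
  by_cases h : wt u % p ^ ℓ = m % p ^ ℓ
  · rw [if_pos h, if_pos (key.2 h)]
  · rw [if_neg h, if_neg fun h' => h (key.1 h')]

/-- [cite: Srinivasan2023, Claim 3.8 (the polynomial Q₁, via Lucas's theorem, Theorem 2.8)] -/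
theorem lucasPoly_ne_zero_iff (p : ℕ) [hp : Fact p.Prime] [CharP F p] (ℓ m : ℕ) (u : Fin n → Bool) :
    lucasPoly F n p ℓ m u ≠ 0 ↔ wt u % p ^ ℓ = m % p ^ ℓ := by
  rw [lucasPoly_apply p]
  split <;> simp [*]


/-! ### Elementary estimates -/

/-- `e^{-2x} ≤ 1 - x` on `[0, 1/2]`.
[cite: Srinivasan2023, Lemma 3.5 (proof: the inequalities 1 - x ≤ e^{-x} and 1 - x ≥ e^{-2x} on [0, 1/2])] -/
private theorem exp_neg_two_mul_le_one_sub {x : ℝ} (h0 : 0 ≤ x) (h1 : x ≤ 1 / 2) :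
    Real.exp (-(2 * x)) ≤ 1 - x := by
  have hpos : 0 < 1 - x := by linarith
  have hlog : -(2 * x) ≤ Real.log (1 - x) := by
    have h := Real.log_le_sub_one_of_pos (inv_pos.2 hpos)
    rw [Real.log_inv] at h
    have hinv : (1 - x)⁻¹ ≤ 1 + 2 * x := by
      rw [inv_eq_one_div, div_le_iff₀ hpos]
      nlinarith
    linarith
  calc Real.exp (-(2 * x)) ≤ Real.exp (Real.log (1 - x)) := Real.exp_le_exp.2 hlog
    _ = 1 - x := Real.exp_log hpos

/-- `(1 - x)^a ≥ e^{-2ax}` on `[0, 1/2]`.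
[cite: Srinivasan2023, Lemma 3.5 (proof: the inequalities 1 - x ≤ e^{-x} and 1 - x ≥ e^{-2x} on [0, 1/2])] -/
private theorem exp_neg_le_one_sub_pow {x : ℝ} (h0 : 0 ≤ x) (h1 : x ≤ 1 / 2) (a : ℕ) :
    Real.exp (-(2 * x * a)) ≤ (1 - x) ^ a := by
  have h := exp_neg_two_mul_le_one_sub h0 h1
  calc Real.exp (-(2 * x * a)) = Real.exp (-(2 * x)) ^ a := by
        rw [← Real.exp_nat_mul]; ring_nf
    _ ≤ (1 - x) ^ a := pow_le_pow_left₀ (Real.exp_nonneg _) h a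

/-- Central binomial coefficient: `16^m ≤ 4m · C(2m, m)²` for `m ≥ 1`.
[cite: Srinivasan2023, Claim 3.9 (proof: Stirling's approximation, C(n, n/2) ≥ 2ⁿ/(2√n))] -/
private theorem sixteen_pow_le (m : ℕ) (hm : 1 ≤ m) : 16 ^ m ≤ 4 * m * (Nat.centralBinom m) ^ 2 := by
  induction m with
  | zero => omega
  | succ m ih =>
    rcases Nat.eq_zero_or_pos m with rfl | hm0
    · simp [Nat.centralBinom]
    · have ih' := ih hm0
      have hrec := Nat.succ_mul_centralBinom_succ m
      -- multiply the goal by `(m+1)^2`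
      have key : (m + 1) ^ 2 * 16 ^ (m + 1) ≤ (m + 1) ^ 2 * (4 * (m + 1) * Nat.centralBinom (m + 1) ^ 2) := by
        have h2 : (m + 1) ^ 2 * (4 * (m + 1) * Nat.centralBinom (m + 1) ^ 2) =
            4 * (m + 1) * ((m + 1) * Nat.centralBinom (m + 1)) ^ 2 := by ring
        rw [h2, hrec]
        have h3 : (2 * m + 1) ^ 2 ≥ 4 * m * (m + 1) := by nlinarith
        calc (m + 1) ^ 2 * 16 ^ (m + 1) = 16 * (m + 1) ^ 2 * 16 ^ m := by ring
          _ ≤ 16 * (m + 1) ^ 2 * (4 * m * Nat.centralBinom m ^ 2) := by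
              exact Nat.mul_le_mul_left _ ih'
          _ = 16 * (m + 1) * (4 * m * (m + 1)) * Nat.centralBinom m ^ 2 := by ring
          _ ≤ 16 * (m + 1) * (2 * m + 1) ^ 2 * Nat.centralBinom m ^ 2 := by
              gcongr
          _ = 4 * (m + 1) * (2 * (2 * m + 1) * Nat.centralBinom m) ^ 2 := by ring
      exact Nat.le_of_mul_le_mul_left key (by positivity)

/-- `4^m ≤ 2√m · C(2m, m)` (so `2^N ≤ √(2N)·C(N, N/2)` for even `N`).
[cite: Srinivasan2023, Claim 3.9 (proof: Stirling's approximation, C(n, n/2) ≥ 2ⁿ/(2√n))] -/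
theorem four_pow_le_sqrt_mul_centralBinom (m : ℕ) (hm : 1 ≤ m) :
    (4 : ℝ) ^ m ≤ 2 * Real.sqrt m * (2 * m).choose m := by
  have h := sixteen_pow_le m hm
  rw [← Nat.centralBinom_eq_two_mul_choose]
  have hsq : ((4 : ℝ) ^ m) ^ 2 ≤ (2 * Real.sqrt m * Nat.centralBinom m) ^ 2 := by
    have : (2 * Real.sqrt m * (Nat.centralBinom m : ℝ)) ^ 2 = 4 * m * (Nat.centralBinom m : ℝ) ^ 2 := by
      rw [mul_pow, mul_pow, Real.sq_sqrt (Nat.cast_nonneg m)]; ring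
    rw [this, ← pow_mul, show m * 2 = 2 * m by ring, pow_mul]
    norm_num
    exact_mod_cast h
  nlinarith [hsq, Real.sqrt_nonneg m, pow_nonneg (by norm_num : (0:ℝ) ≤ 4) m,
    show (0:ℝ) ≤ 2 * Real.sqrt m * Nat.centralBinom m by positivity]

/-! ### Ratios of binomial coefficients near the middle (Srinivasan's Lemma 3.5) -/

/-- One step down from the middle: `C(2m, m-j-1)·(m+j+1) = C(2m, m-j)·(m-j)`. [folklore] -/
private theorem choose_middle_step (m j : ℕ) (hj : j < m) :
    (2 * m).choose (m - (j + 1)) * (m + j + 1) = (2 * m).choose (m - j) * (m - j) := by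
  have h := Nat.choose_succ_right_eq (2 * m) (m - (j + 1))
  have e1 : m - (j + 1) + 1 = m - j := by omega
  have e2 : 2 * m - (m - (j + 1)) = m + j + 1 := by omega
  rw [e1, e2] at h
  exact h.symm

/-- Upper ratio bound: for `t ≤ a ≤ b ≤ m`, `C(2m, m-b) ≤ C(2m, m-a)·(1 - t/m)^{b-a}`.
[cite: Srinivasan2023, Lemma 3.5] -/
theorem choose_ratio_upper (m t a : ℕ) (hta : t ≤ a) :
    ∀ b, a ≤ b → b ≤ m →
      ((2 * m).choose (m - b) : ℝ) ≤ (2 * m).choose (m - a) * (1 - (t : ℝ) / m) ^ (b - a) := by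
  intro b hab hbm
  induction b, hab using Nat.le_induction with
  | base => simp
  | succ b hab ih =>
    have hbm' : b < m := by omega
    have ih' := ih hbm'.le
    have hm : (0 : ℝ) < m := by exact_mod_cast (show 0 < m by omega)
    have hstep := choose_middle_step m b hbm'
    have hstepR : ((2 * m).choose (m - (b + 1)) : ℝ) * (m + b + 1) =
        (2 * m).choose (m - b) * (m - b) := by
      have : ((m - b : ℕ) : ℝ) = (m : ℝ) - b := by push_cast [Nat.cast_sub hbm'.le]; ring
      rw [← this]; exact_mod_cast hstep
    have hpos : (0 : ℝ) < m + b + 1 := by positivity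
    -- `C(m-(b+1)) = C(m-b)·(m-b)/(m+b+1) ≤ C(m-b)·(1 - t/m)`
    have hfac : ((m : ℝ) - b) / (m + b + 1) ≤ 1 - (t : ℝ) / m := by
      rw [div_le_iff₀ hpos]
      have ht : (t : ℝ) ≤ b := by exact_mod_cast (hta.trans hab)
      have h1 : (1 - (t : ℝ) / m) * (m + b + 1) = (m + b + 1) - t * (m + b + 1) / m := by ring
      rw [h1]
      have htm : (t : ℝ) ≤ m := by exact_mod_cast (hta.trans (hab.trans hbm'.le))
      have h3 : (t : ℝ) * (m + b + 1) / m ≤ t + (b + 1) := by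
        rw [div_le_iff₀ hm]; nlinarith
      nlinarith
    have hnn : (0 : ℝ) ≤ 1 - (t : ℝ) / m := by
      rw [sub_nonneg, div_le_one hm]; exact_mod_cast (hta.trans (hab.trans hbm'.le))
    calc ((2 * m).choose (m - (b + 1)) : ℝ)
        = (2 * m).choose (m - b) * (((m : ℝ) - b) / (m + b + 1)) := by
          rw [mul_div_assoc', eq_div_iff hpos.ne', hstepR]
      _ ≤ (2 * m).choose (m - a) * (1 - (t : ℝ) / m) ^ (b - a) * (1 - (t : ℝ) / m) :=
          mul_le_mul ih' hfac (div_nonneg (sub_nonneg.2 (by exact_mod_cast hbm'.le)) hpos.le)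
            (mul_nonneg (Nat.cast_nonneg _) (pow_nonneg hnn _))
      _ = (2 * m).choose (m - a) * (1 - (t : ℝ) / m) ^ (b + 1 - a) := by
          rw [mul_assoc, ← pow_succ, show b + 1 - a = b - a + 1 by omega]

/-- Lower ratio bound: for `a ≤ c ≤ b` with `2b ≤ m`:
`C(2m, m-a)·(1 - 2b/m)^{c-a} ≤ C(2m, m-c)`.
[cite: Srinivasan2023, Lemma 3.5] -/
theorem choose_ratio_lower (m a b : ℕ) (hbm : 2 * b ≤ m) :
    ∀ c, a ≤ c → c ≤ b →
      ((2 * m).choose (m - a) : ℝ) * (1 - 2 * (b : ℝ) / m) ^ (c - a) ≤ (2 * m).choose (m - c) := by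
  intro c hac hcb
  induction c, hac using Nat.le_induction with
  | base => simp
  | succ c hac ih =>
    have hcb' : c < b := by omega
    have ih' := ih hcb'.le
    have hcm : c < m := by omega
    have hm : (0 : ℝ) < m := by exact_mod_cast (show 0 < m by omega)
    have hstep := choose_middle_step m c hcm
    have hstepR : ((2 * m).choose (m - (c + 1)) : ℝ) * (m + c + 1) =
        (2 * m).choose (m - c) * (m - c) := by
      have : ((m - c : ℕ) : ℝ) = (m : ℝ) - c := by push_cast [Nat.cast_sub hcm.le]; ring
      rw [← this]; exact_mod_cast hstep
    have hpos : (0 : ℝ) < m + c + 1 := by positivity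
    have hfac : 1 - 2 * (b : ℝ) / m ≤ ((m : ℝ) - c) / (m + c + 1) := by
      rw [le_div_iff₀ hpos]
      have hc1 : (c : ℝ) + 1 ≤ b := by exact_mod_cast hcb'
      have hb : 2 * (b : ℝ) ≤ m := by exact_mod_cast hbm
      have h1 : (1 - 2 * (b : ℝ) / m) * (m + c + 1) = (m + c + 1) - 2 * b * (m + c + 1) / m := by ring
      rw [h1]
      have h2 : 2 * (b : ℝ) * (m + c + 1) / m ≥ 2 * b := by
        rw [ge_iff_le, le_div_iff₀ hm]; nlinarith
      nlinarith
    have hnn : (0 : ℝ) ≤ 1 - 2 * (b : ℝ) / m := by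
      rw [sub_nonneg, div_le_one hm]; exact_mod_cast hbm
    calc ((2 * m).choose (m - a) : ℝ) * (1 - 2 * (b : ℝ) / m) ^ (c + 1 - a)
        = (2 * m).choose (m - a) * (1 - 2 * (b : ℝ) / m) ^ (c - a) * (1 - 2 * (b : ℝ) / m) := by
          rw [mul_assoc, ← pow_succ, show c + 1 - a = c - a + 1 by omega]
      _ ≤ (2 * m).choose (m - c) * (((m : ℝ) - c) / (m + c + 1)) :=
          mul_le_mul ih' hfac hnn (by positivity)
      _ = ((2 * m).choose (m - (c + 1)) : ℝ) := by
          rw [mul_div_assoc', div_eq_iff hpos.ne', hstepR]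


/-! ### Complementing all variables (Remark 3.3) -/

/-- `P ↦ P(1 - x₁, …, 1 - xₙ)` (Srinivasan: "consider the polynomial `Q(x) = P(1-x₁,…,1-xₙ)`
instead"; Remark 3.3: "by negating inputs").
[cite: Srinivasan2023, Remark 3.3 (negating inputs); Lemma 3.1 (proof: Q(x) = P(1 - x₁, …, 1 - xₙ))] -/
def cpl (P : CubeFn F n) : CubeFn F n := fun u => P fun i => !u i

/-- Auxiliary. [folklore] -/
private theorem cpl_mono_eq (S : Finset (Fin n)) :
    cpl (mono F S) = ∑ T ∈ S.powerset, ((-1 : F) ^ T.card) • mono F T := by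
  funext u
  simp only [cpl, Finset.sum_apply, Pi.smul_apply, smul_eq_mul, mono]
  have h : ∀ i ∈ S, (if (!u i) = true then (1 : F) else 0) = 1 + -(if u i = true then (1 : F) else 0) := by
    intro i _; cases u i <;> simp
  rw [Finset.prod_congr rfl h, Finset.prod_one_add]
  refine Finset.sum_congr rfl fun T _ => ?_
  rw [Finset.prod_neg]

/-- [cite: Srinivasan2023, Remark 3.3 (negating inputs); Lemma 3.1 (proof: Q(x) = P(1 - x₁, …, 1 - xₙ))] -/
theorem cpl_mem_lowDeg {D : ℕ} {P : CubeFn F n} (hP : P ∈ lowDeg F n D) : cpl P ∈ lowDeg F n D := by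
  let L : CubeFn F n →ₗ[F] CubeFn F n :=
    { toFun := cpl, map_add' := fun _ _ => rfl, map_smul' := fun _ _ => rfl }
  have hle : (lowDeg F n D).map L ≤ lowDeg F n D := by
    rw [lowDeg_eq_span (D := D), Submodule.map_span_le]
    rintro _ ⟨⟨S, hS⟩, rfl⟩
    change cpl (mono F S) ∈ _
    rw [cpl_mono_eq]
    refine Submodule.sum_mem _ fun T hT => Submodule.smul_mem _ _ (mono_mem_lowDeg ?_)
    exact (Finset.card_le_card (Finset.mem_powerset.1 hT)).trans hS
  exact hle (Submodule.mem_map_of_mem hP)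

/-- [cite: Srinivasan2023, Remark 3.3 (negating inputs); Lemma 3.1 (proof: Q(x) = P(1 - x₁, …, 1 - xₙ))] -/
theorem wt_not (u : Fin n → Bool) : wt (fun i => !u i) = n - wt u := by
  unfold wt
  have h : (univ.filter fun i => (!u i) = true) = univ.filter fun i => ¬ (u i = true) := by
    ext i; simp
  rw [h, Finset.filter_not, Finset.card_univ_sdiff, Fintype.card_fin]

/-! ### Permutations of the coordinates -/

/-- [cite: Srinivasan2023, Lemma 3.10 (proof: a^π is uniformly distributed over the layer)] -/
theorem wt_comp_perm (u : Fin n → Bool) (π : Equiv.Perm (Fin n)) : wt (u ∘ π) = wt u := by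
  unfold wt
  refine Finset.card_bij (fun i _ => π i) (fun i hi => ?_) (fun i _ j _ h => π.injective h)
    (fun j hj => ⟨π.symm j, ?_, π.apply_symm_apply j⟩)
  · simpa using hi
  · simpa using hj

/-- [cite: Srinivasan2023, Lemma 3.10 (proof: a^π is uniformly distributed over the layer)] -/
theorem comp_perm_mem_lowDeg (π : Equiv.Perm (Fin n)) {D : ℕ} {P : CubeFn F n}
    (hP : P ∈ lowDeg F n D) : (fun x => P (x ∘ π)) ∈ lowDeg F n D :=
  comp_subst_mem_lowDeg (fun x => x ∘ π) (fun i => Or.inr ⟨π i, fun _ => rfl⟩) hP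

/-- Points of equal weight are permutations of each other.
[cite: Srinivasan2023, Lemma 3.10 (proof: a^π is uniformly distributed over the layer)] -/
theorem exists_perm_of_wt_eq {u b : Fin n → Bool} (h : wt u = wt b) :
    ∃ σ : Equiv.Perm (Fin n), u = b ∘ σ := by
  classical
  have hc1 : Fintype.card {i // u i = true} = Fintype.card {i // b i = true} := by
    rw [Fintype.card_subtype, Fintype.card_subtype]
    exact h
  have hc2 : Fintype.card {i // ¬ u i = true} = Fintype.card {i // ¬ b i = true} := by
    rw [Fintype.card_subtype_compl, Fintype.card_subtype_compl, hc1]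
  let e₁ : {i // u i = true} ≃ {i // b i = true} := Fintype.equivOfCardEq hc1
  let e₂ : {i // ¬ u i = true} ≃ {i // ¬ b i = true} := Fintype.equivOfCardEq hc2
  refine ⟨(Equiv.sumCompl fun i => u i = true).symm.trans
    ((e₁.sumCongr e₂).trans (Equiv.sumCompl fun i => b i = true)), ?_⟩
  funext i
  simp only [Function.comp_apply, Equiv.trans_apply]
  by_cases hi : u i = true
  · rw [Equiv.sumCompl_symm_apply_of_pos (p := fun i => u i = true) hi]
    simp only [Equiv.sumCongr_apply, Sum.map_inl, Equiv.sumCompl_apply_inl]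
    rw [hi]
    exact (e₁ ⟨i, hi⟩).2.symm
  · rw [Equiv.sumCompl_symm_apply_of_neg (p := fun i => u i = true) hi]
    simp only [Equiv.sumCongr_apply, Sum.map_inr, Equiv.sumCompl_apply_inr]
    rw [Bool.eq_false_iff.2 hi]
    exact (Bool.eq_false_iff.2 (e₂ ⟨i, hi⟩).2).symm

/-! ### Restriction to a subcube: free coordinates `< N`, then `r₁` ones, then zeros -/

/-- Extend `a ∈ {0,1}^N` to `{0,1}ⁿ`: coordinates `< N` from `a`, the next `r₁` set to `1`, the
rest to `0`.
[cite: Srinivasan2023, Lemma 3.1 (proof, §3.2: the restriction P_{S,y} and the product Q^{(r)} of Lemma 3.10)] -/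
def extendPt (n N r₁ : ℕ) (a : Fin N → Bool) : Fin n → Bool :=
  fun i => if h : (i : ℕ) < N then a ⟨i, h⟩ else decide ((i : ℕ) < N + r₁)

/-- Auxiliary. [folklore] -/
private theorem wt_eq_sum (u : Fin n → Bool) : wt u = ∑ i, (if u i = true then 1 else 0) := by
  unfold wt
  rw [Finset.card_filter]

/-- [cite: Srinivasan2023, Lemma 3.1 (proof, §3.2: the restriction P_{S,y} and the product Q^{(r)} of Lemma 3.10)] -/
theorem wt_extendPt {N r₁ : ℕ} (hle : N + r₁ ≤ n) (a : Fin N → Bool) :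
    wt (extendPt n N r₁ a) = wt a + r₁ := by
  set g : ℕ → ℕ := fun i => if h : i < N then (if a ⟨i, h⟩ = true then 1 else 0)
    else (if i < N + r₁ then 1 else 0) with hg
  have h1 : wt (extendPt n N r₁ a) = ∑ i ∈ range n, g i := by
    rw [wt_eq_sum, ← Fin.sum_univ_eq_sum_range]
    refine Finset.sum_congr rfl fun i _ => ?_
    simp only [extendPt, hg]
    split
    · rfl
    · simp
  have h2 : wt a = ∑ i ∈ range N, g i := by
    rw [wt_eq_sum, ← Fin.sum_univ_eq_sum_range]
    refine Finset.sum_congr rfl fun i _ => ?_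
    simp only [hg, dif_pos i.2]
  have h3 : ∑ i ∈ Ico N n, g i = r₁ := by
    have : ∀ i ∈ Ico N n, g i = if i < N + r₁ then 1 else 0 := by
      intro i hi
      rw [Finset.mem_Ico] at hi
      simp only [hg, dif_neg (not_lt.2 hi.1)]
    rw [Finset.sum_congr rfl this, Finset.sum_boole]
    have hf : (Ico N n).filter (fun i => i < N + r₁) = Ico N (N + r₁) := by
      ext i
      simp only [Finset.mem_filter, Finset.mem_Ico]
      omega
    rw [hf, Nat.card_Ico]
    simp
  rw [h1, ← Finset.sum_range_add_sum_Ico g (show N ≤ n by omega), ← h2, h3]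

/-- [cite: Srinivasan2023, Lemma 3.1 (proof, §3.2: the restriction P_{S,y} and the product Q^{(r)} of Lemma 3.10)] -/
theorem extendPt_mem_layer {N r₁ j : ℕ} (hle : N + r₁ ≤ n) {a : Fin N → Bool}
    (ha : a ∈ layer N j) : extendPt n N r₁ a ∈ layer n (j + r₁) := by
  rw [mem_layer_iff] at ha ⊢
  rw [wt_extendPt hle, ha]

/-- `a ↦ P(extendPt(a) ∘ π)` is a substitution of variables, so it preserves `lowDeg`.
[cite: Srinivasan2023, Lemma 3.1 (proof, §3.2: the restriction P_{S,y} and the product Q^{(r)} of Lemma 3.10)] -/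
theorem comp_extendPt_perm_mem_lowDeg (N r₁ : ℕ) (π : Equiv.Perm (Fin n)) {D : ℕ} {P : CubeFn F n}
    (hP : P ∈ lowDeg F n D) :
    (fun a : Fin N → Bool => P (extendPt n N r₁ a ∘ π)) ∈ lowDeg F N D := by
  refine comp_subst_mem_lowDeg (fun a : Fin N → Bool => extendPt n N r₁ a ∘ π) (fun i => ?_) hP
  by_cases h : ((π i : Fin n) : ℕ) < N
  · exact Or.inr ⟨⟨(π i : ℕ), h⟩, fun a => by simp [extendPt, h]⟩
  · exact Or.inl ⟨decide (((π i : Fin n) : ℕ) < N + r₁), fun a => by simp [extendPt, h]⟩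

/-- Products of members of `lowDeg D` lie in `lowDeg (#factors · D)`.
[cite: Srinivasan2023, Lemma 3.1 (proof, §3.2: the restriction P_{S,y} and the product Q^{(r)} of Lemma 3.10)] -/
theorem prod_mem_lowDeg {ι : Type*} (s : Finset ι) {N D : ℕ} (f : ι → CubeFn F N)
    (h : ∀ i ∈ s, f i ∈ lowDeg F N D) : (∏ i ∈ s, f i) ∈ lowDeg F N (s.card * D) := by
  classical
  induction s using Finset.induction_on with
  | empty =>
    rw [Finset.prod_empty, Finset.card_empty, zero_mul]
    exact one_mem_lowDeg 0
  | insert a s has ih =>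
    rw [Finset.prod_insert has, Finset.card_insert_of_notMem has, add_mul, one_mul, add_comm]
    exact mul_mem_lowDeg_add (h a (Finset.mem_insert_self a s))
      (ih fun i hi => h i (Finset.mem_insert_of_mem hi))

/-- The amplified restriction `Q_{π⃗}(a) = Π_i P(extendPt(a) ∘ π_i)` (Srinivasan's `P''`: a product
of `r` randomly permuted copies of `P`, restricted to a subcube).
[cite: Srinivasan2023, Lemma 3.1 (proof, §3.2: the restriction P_{S,y} and the product Q^{(r)} of Lemma 3.10)] -/
def ampRestrict (P : CubeFn F n) (N r₁ : ℕ) {r : ℕ} (πs : Fin r → Equiv.Perm (Fin n)) :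
    CubeFn F N :=
  ∏ i : Fin r, fun a => P (extendPt n N r₁ a ∘ πs i)

/-- [cite: Srinivasan2023, Lemma 3.1 (proof, §3.2: the restriction P_{S,y} and the product Q^{(r)} of Lemma 3.10)] -/
theorem ampRestrict_apply (P : CubeFn F n) (N r₁ : ℕ) {r : ℕ} (πs : Fin r → Equiv.Perm (Fin n))
    (a : Fin N → Bool) : ampRestrict P N r₁ πs a = ∏ i : Fin r, P (extendPt n N r₁ a ∘ πs i) := by
  unfold ampRestrict
  rw [Finset.prod_apply]

/-- [cite: Srinivasan2023, Lemma 3.1 (proof, §3.2: the restriction P_{S,y} and the product Q^{(r)} of Lemma 3.10)] -/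
theorem ampRestrict_mem_lowDeg {D : ℕ} {P : CubeFn F n} (hP : P ∈ lowDeg F n D) (N r₁ : ℕ)
    {r : ℕ} (πs : Fin r → Equiv.Perm (Fin n)) : ampRestrict P N r₁ πs ∈ lowDeg F N (r * D) := by
  have h := prod_mem_lowDeg (univ : Finset (Fin r)) (fun i => fun a : Fin N → Bool =>
    P (extendPt n N r₁ a ∘ πs i)) fun i _ => comp_extendPt_perm_mem_lowDeg N r₁ (πs i) hP
  rwa [Finset.card_univ, Fintype.card_fin] at h

/-- [cite: Srinivasan2023, Lemma 3.1 (proof, §3.2: the restriction P_{S,y} and the product Q^{(r)} of Lemma 3.10)] -/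
theorem ampRestrict_ne_zero_iff (P : CubeFn F n) (N r₁ : ℕ) {r : ℕ}
    (πs : Fin r → Equiv.Perm (Fin n)) (a : Fin N → Bool) :
    ampRestrict P N r₁ πs a ≠ 0 ↔ ∀ i, P (extendPt n N r₁ a ∘ πs i) ≠ 0 := by
  rw [ampRestrict_apply, Finset.prod_ne_zero_iff]
  simp

/-! ### Markov-type selection -/

/-- If `f ≥ 0` averages at most `A` and `g ≤ 1` averages at least `B > 0`, some point has
`f ≤ 2A/B` and `g > B/2` simultaneously (Srinivasan: "by Markov's inequality … with positive
probability").
[cite: Srinivasan2023, Lemma 3.1 (proof, §3.2: "By Markov's inequality … with positive probability")] -/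
theorem exists_le_and_lt {ι : Type*} [Fintype ι] [Nonempty ι] (f g : ι → ℝ) {A B : ℝ}
    (hf : ∀ i, 0 ≤ f i) (hg1 : ∀ i, g i ≤ 1) (hA : 0 ≤ A) (hB : 0 < B)
    (hfs : ∑ i, f i ≤ Fintype.card ι * A) (hgs : Fintype.card ι * B ≤ ∑ i, g i) :
    ∃ i, f i ≤ 2 * A / B ∧ B / 2 < g i := by
  classical
  by_contra hcon
  push Not at hcon
  set S : Finset ι := univ.filter fun i => B / 2 < g i with hS
  -- (1) the `g`-sum forces `S` to be large
  have hg_le : ∑ i, g i ≤ S.card + (Fintype.card ι - S.card) * (B / 2) := by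
    rw [← Finset.sum_filter_add_sum_filter_not univ (fun i => B / 2 < g i)]
    have ha : ∑ i ∈ univ.filter (fun i => B / 2 < g i), g i ≤ S.card := by
      rw [hS]
      calc ∑ i ∈ univ.filter (fun i => B / 2 < g i), g i
          ≤ ∑ _i ∈ univ.filter (fun i => B / 2 < g i), (1 : ℝ) := Finset.sum_le_sum fun i _ => hg1 i
        _ = _ := by rw [Finset.sum_const, nsmul_eq_mul, mul_one]
    have hcardc : (((univ : Finset ι).filter fun i => ¬ B / 2 < g i).card : ℝ) =
        Fintype.card ι - S.card := by
      have := Finset.card_filter_add_card_filter_not (s := (univ : Finset ι))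
        (fun i => B / 2 < g i)
      rw [Finset.card_univ] at this
      rw [hS, eq_sub_iff_add_eq, add_comm]
      exact_mod_cast this
    have hb : ∑ i ∈ univ.filter (fun i => ¬ B / 2 < g i), g i ≤
        (Fintype.card ι - S.card) * (B / 2) := by
      calc ∑ i ∈ univ.filter (fun i => ¬ B / 2 < g i), g i
          ≤ ∑ _i ∈ univ.filter (fun i => ¬ B / 2 < g i), B / 2 :=
            Finset.sum_le_sum fun i hi => not_lt.1 (Finset.mem_filter.1 hi).2
        _ = (Fintype.card ι - S.card) * (B / 2) := by
            rw [Finset.sum_const, nsmul_eq_mul, hcardc]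
    exact add_le_add ha hb
  have hSc : (S.card : ℝ) ≤ Fintype.card ι := by exact_mod_cast Finset.card_le_univ S
  have hS_ge : (Fintype.card ι : ℝ) * B / 2 ≤ S.card := by nlinarith [hgs, hg_le, hSc, hB]
  -- (2) hence `S` is non-empty and the `f`-sum over `S` is too large
  have hcard_pos : (0 : ℝ) < Fintype.card ι := by exact_mod_cast Fintype.card_pos
  have hSne : S.Nonempty := by
    rw [← Finset.card_pos]
    have : (0 : ℝ) < S.card := lt_of_lt_of_le (by positivity) hS_ge
    exact_mod_cast this
  have hfS : ∀ i ∈ S, 2 * A / B < f i := fun i hi => by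
    by_contra hle
    exact absurd (hcon i (not_lt.1 hle)) (not_le.2 (Finset.mem_filter.1 hi).2)
  have hlt : (S.card : ℝ) * (2 * A / B) < ∑ i ∈ S, f i := by
    have := Finset.sum_lt_sum_of_nonempty hSne hfS
    rwa [Finset.sum_const, nsmul_eq_mul] at this
  have hle : ∑ i ∈ S, f i ≤ ∑ i, f i :=
    Finset.sum_le_sum_of_subset_of_nonneg (Finset.subset_univ S) fun i _ _ => hf i
  have hkey : (Fintype.card ι : ℝ) * B / 2 * (2 * A / B) ≤ S.card * (2 * A / B) :=
    mul_le_mul_of_nonneg_right hS_ge (by positivity)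
  have hid : (Fintype.card ι : ℝ) * B / 2 * (2 * A / B) = Fintype.card ι * A := by
    field_simp
  linarith

variable [DecidableEq F]


/-- [cite: Srinivasan2023, Remark 3.3 (negating inputs); Lemma 3.1 (proof: Q(x) = P(1 - x₁, …, 1 - xₙ))] -/
theorem nzFrac_cpl (P : CubeFn F n) {m : ℕ} (hm : m ≤ n) : nzFrac (cpl P) m = nzFrac P (n - m) := by
  unfold nzFrac
  rw [Nat.choose_symm hm]
  congr 1
  norm_cast
  refine Finset.card_bij (fun u _ => fun i => !u i) (fun u hu => ?_) (fun u _ v _ h => ?_)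
    (fun v hv => ⟨fun i => !v i, ?_, ?_⟩)
  · rw [Finset.mem_filter, mem_layer_iff] at hu ⊢
    rw [wt_not, hu.1]
    exact ⟨rfl, hu.2⟩
  · funext i
    have := congrFun h i
    simpa using this
  · rw [Finset.mem_filter, mem_layer_iff] at hv ⊢
    rw [wt_not, hv.1]
    refine ⟨by omega, ?_⟩
    have : (fun i => !(fun i => !v i) i) = v := by funext i; simp
    simp only [cpl]
    rw [this]; exact hv.2
  · funext i; simp



/-- The number of permutations `π` with `P(b ∘ π) ≠ 0` does not depend on `b` within a layer. [folklore] -/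
private theorem card_perm_filter_eq_of_wt_eq (P : CubeFn F n) {u b : Fin n → Bool} (h : wt u = wt b) :
    ((univ : Finset (Equiv.Perm (Fin n))).filter fun π : Equiv.Perm (Fin n) => P (u ∘ ⇑π) ≠ 0).card =
      ((univ : Finset (Equiv.Perm (Fin n))).filter fun π : Equiv.Perm (Fin n) => P (b ∘ ⇑π) ≠ 0).card := by
  obtain ⟨σ, rfl⟩ := exists_perm_of_wt_eq h
  have hcomp : ∀ π : Equiv.Perm (Fin n), (b ∘ ⇑σ) ∘ ⇑π = b ∘ ⇑(σ * π) := fun π => by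
    funext i; simp [Equiv.Perm.coe_mul]
  refine Finset.card_bij (fun π _ => σ * π) (fun π hπ => ?_) (fun π _ π' _ hh => mul_left_cancel hh)
    (fun π hπ => ⟨σ⁻¹ * π, ?_, by simp⟩)
  · simp only [Finset.mem_filter, Finset.mem_univ, true_and] at hπ ⊢
    rwa [hcomp] at hπ
  · simp only [Finset.mem_filter, Finset.mem_univ, true_and] at hπ ⊢
    rwa [hcomp, mul_inv_cancel_left]

/-- Double counting: `#{π | P(b∘π) ≠ 0} · C(n,m) = n! · #{u ∈ layer m | P u ≠ 0}` for `b` of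
weight `m` (Srinivasan's `Pr_π[Q^π(a) ≠ 0] = ψ_m(Q)`).
[cite: Srinivasan2023, Lemma 3.10 (proof: a^π is uniformly distributed over the layer)] -/
theorem card_perm_filter_mul_choose (P : CubeFn F n) {m : ℕ} {b : Fin n → Bool}
    (hb : b ∈ layer n m) :
    ((univ : Finset (Equiv.Perm (Fin n))).filter fun π : Equiv.Perm (Fin n) => P (b ∘ ⇑π) ≠ 0).card * n.choose m =
      Fintype.card (Equiv.Perm (Fin n)) * ((layer n m).filter fun u => P u ≠ 0).card := by
  -- `Σ_{u ∈ layer m} #{π | P(u∘π) ≠ 0}` computed in two ways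
  have hsum : ∑ u ∈ layer n m, ((univ : Finset (Equiv.Perm (Fin n))).filter
      fun π : Equiv.Perm (Fin n) => P (u ∘ ⇑π) ≠ 0).card =
      ∑ π : Equiv.Perm (Fin n), ((layer n m).filter fun u => P (u ∘ π) ≠ 0).card := by
    simp only [Finset.card_filter]
    exact Finset.sum_comm
  have h1 : ∀ u ∈ layer n m, ((univ : Finset (Equiv.Perm (Fin n))).filter
      fun π : Equiv.Perm (Fin n) => P (u ∘ ⇑π) ≠ 0).card =
      ((univ : Finset (Equiv.Perm (Fin n))).filter fun π : Equiv.Perm (Fin n) => P (b ∘ ⇑π) ≠ 0).card := fun u hu =>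
    card_perm_filter_eq_of_wt_eq P ((mem_layer_iff.1 hu).trans (mem_layer_iff.1 hb).symm)
  have h2 : ∀ π : Equiv.Perm (Fin n), ((layer n m).filter fun u => P (u ∘ π) ≠ 0).card =
      ((layer n m).filter fun u => P u ≠ 0).card := by
    intro π
    refine Finset.card_bij (fun u _ => u ∘ π) (fun u hu => ?_) (fun u _ v _ h => ?_)
      (fun v hv => ⟨v ∘ ⇑π.symm, ?_, ?_⟩)
    · rw [Finset.mem_filter, mem_layer_iff] at hu ⊢
      rw [wt_comp_perm]
      exact hu
    · funext i
      have := congrFun h (π.symm i)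
      simpa using this
    · rw [Finset.mem_filter, mem_layer_iff] at hv ⊢
      rw [wt_comp_perm]
      refine ⟨hv.1, ?_⟩
      have : (v ∘ ⇑π.symm) ∘ ⇑π = v := by funext i; simp
      rw [this]; exact hv.2
    · funext i; simp
  rw [Finset.sum_congr rfl h1, Finset.sum_const, card_layer, smul_eq_mul,
    Finset.sum_congr rfl fun π _ => h2 π, Finset.sum_const, Finset.card_univ, smul_eq_mul] at hsum
  rw [mul_comm]
  exact hsum

/-- In real form: `#{π | P(b∘π) ≠ 0} = n! · nzFrac P m` for `b ∈ layer m`, `m ≤ n`.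
[cite: Srinivasan2023, Lemma 3.10 (proof: a^π is uniformly distributed over the layer)] -/
theorem card_perm_filter_eq_mul_nzFrac (P : CubeFn F n) {m : ℕ} (hm : m ≤ n) {b : Fin n → Bool}
    (hb : b ∈ layer n m) :
    (((univ : Finset (Equiv.Perm (Fin n))).filter fun π : Equiv.Perm (Fin n) => P (b ∘ ⇑π) ≠ 0).card : ℝ) =
      (Fintype.card (Equiv.Perm (Fin n)) : ℝ) * nzFrac P m := by
  have h := card_perm_filter_mul_choose P hb
  have hc : (n.choose m : ℝ) ≠ 0 := by exact_mod_cast (Nat.choose_pos hm).ne'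
  unfold nzFrac
  rw [mul_div_assoc', eq_div_iff hc]
  exact_mod_cast h

/-- `r`-fold version (independent permutations): the count is the `r`-th power.
[cite: Srinivasan2023, Lemma 3.10 (proof: a^π is uniformly distributed over the layer)] -/
theorem card_pi_perm_filter (P : CubeFn F n) (b : Fin n → Bool) (r : ℕ) :
    ((univ : Finset (Fin r → Equiv.Perm (Fin n))).filter fun πs : Fin r → Equiv.Perm (Fin n) => ∀ i, P (b ∘ ⇑(πs i)) ≠ 0).card =
      (((univ : Finset (Equiv.Perm (Fin n))).filter fun π : Equiv.Perm (Fin n) => P (b ∘ ⇑π) ≠ 0).card) ^ r := by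
  classical
  have hset : ((univ : Finset (Fin r → Equiv.Perm (Fin n))).filter fun πs : Fin r → Equiv.Perm (Fin n) => ∀ i, P (b ∘ ⇑(πs i)) ≠ 0)
      = Fintype.piFinset fun _ : Fin r =>
          (univ : Finset (Equiv.Perm (Fin n))).filter fun π : Equiv.Perm (Fin n) => P (b ∘ ⇑π) ≠ 0 := by
    ext πs
    simp only [Finset.mem_filter, Finset.mem_univ, true_and, Fintype.mem_piFinset]
  rw [hset, Fintype.card_piFinset, Finset.prod_const, Finset.card_univ, Fintype.card_fin]

/-- **Averaging (Srinivasan's Lemma 3.10 + the restriction step)**: the average over `π⃗` of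
`ψ_j(Q_{π⃗})` is `ψ_{j + r₁}(P)^r`.
[cite: Srinivasan2023, Lemma 3.1 (proof, §3.2: the restriction P_{S,y} and the product Q^{(r)} of Lemma 3.10)] -/
theorem sum_nzFrac_ampRestrict (P : CubeFn F n) {N r₁ : ℕ} (hle : N + r₁ ≤ n) (r : ℕ) {j : ℕ}
    (hj : j ≤ N) :
    ∑ πs : Fin r → Equiv.Perm (Fin n), nzFrac (ampRestrict P N r₁ πs) j =
      ((Fintype.card (Equiv.Perm (Fin n)) : ℝ) * nzFrac P (j + r₁)) ^ r := by
  have hcN : (N.choose j : ℝ) ≠ 0 := by exact_mod_cast (Nat.choose_pos hj).ne'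
  -- count pairs `(π⃗, a)`
  have hcount : ∑ πs : Fin r → Equiv.Perm (Fin n),
      (((layer N j).filter fun a => ampRestrict P N r₁ πs a ≠ 0).card : ℝ) =
      ∑ a ∈ layer N j, ((((univ : Finset (Equiv.Perm (Fin n))).filter
        fun π : Equiv.Perm (Fin n) => P (extendPt n N r₁ a ∘ ⇑π) ≠ 0).card : ℝ) ^ r) := by
    have h1 : ∀ πs : Fin r → Equiv.Perm (Fin n),
        (((layer N j).filter fun a => ampRestrict P N r₁ πs a ≠ 0).card : ℝ) =
        ∑ a ∈ layer N j, (if ∀ i, P (extendPt n N r₁ a ∘ πs i) ≠ 0 then (1 : ℝ) else 0) := by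
      intro πs
      rw [Finset.card_filter]
      push_cast
      refine Finset.sum_congr rfl fun a _ => ?_
      by_cases h : ∀ i, P (extendPt n N r₁ a ∘ ⇑(πs i)) ≠ 0
      · rw [if_pos h, if_pos ((ampRestrict_ne_zero_iff P N r₁ πs a).2 h)]
      · rw [if_neg h, if_neg fun h' => h ((ampRestrict_ne_zero_iff P N r₁ πs a).1 h')]
    rw [Finset.sum_congr rfl fun πs _ => h1 πs, Finset.sum_comm]
    refine Finset.sum_congr rfl fun a _ => ?_
    rw [← Nat.cast_pow, ← card_pi_perm_filter, Finset.card_filter]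
    push_cast
    rfl
  have h2 : ∀ a ∈ layer N j, ((((univ : Finset (Equiv.Perm (Fin n))).filter
      fun π : Equiv.Perm (Fin n) => P (extendPt n N r₁ a ∘ ⇑π) ≠ 0).card : ℝ) ^ r) =
      ((Fintype.card (Equiv.Perm (Fin n)) : ℝ) * nzFrac P (j + r₁)) ^ r := fun a ha => by
    rw [card_perm_filter_eq_mul_nzFrac P (by omega) (extendPt_mem_layer hle ha)]
  rw [Finset.sum_congr rfl h2, Finset.sum_const, card_layer, nsmul_eq_mul] at hcount
  calc ∑ πs : Fin r → Equiv.Perm (Fin n), nzFrac (ampRestrict P N r₁ πs) j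
      = ∑ πs : Fin r → Equiv.Perm (Fin n),
          (((layer N j).filter fun a => ampRestrict P N r₁ πs a ≠ 0).card : ℝ) / (N.choose j : ℝ) :=
        rfl
    _ = _ := by rw [← Finset.sum_div, hcount, mul_div_cancel_left₀ _ hcN]


/-! ### Monotonicity of binomial coefficients below the middle; `N_D` from below -/

/-- Auxiliary. [folklore] -/
private theorem choose_mono_half (N : ℕ) {s j : ℕ} (hsj : s ≤ j) (hj : j ≤ N / 2) :
    N.choose s ≤ N.choose j := by
  induction j, hsj using Nat.le_induction with
  | base => exact le_rfl
  | succ j hsj ih =>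
    exact (ih (by omega)).trans (Nat.choose_le_succ_of_lt_half_left (by omega))

/-- `c · C(N, s) ≤ N_D` whenever the `c` consecutive indices `s, …, s+c-1` are `≤ D ≤ N/2`.
[cite: Srinivasan2023, Claim 3.9 (proof: N_D ≥ t₁·C(n, m - t - 2t₁))] -/
theorem mul_choose_le_numMonomials {N D s c : ℕ} (h : s + c ≤ D + 1) (hD : D ≤ N / 2) :
    c * N.choose s ≤ numMonomials N D := by
  unfold numMonomials
  calc c * N.choose s = ∑ _j ∈ Ico s (s + c), N.choose s := by
        rw [Finset.sum_const, Nat.card_Ico, smul_eq_mul]; congr 1; omega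
    _ ≤ ∑ j ∈ Ico s (s + c), N.choose j :=
        Finset.sum_le_sum fun j hj => choose_mono_half N (Finset.mem_Ico.1 hj).1
          (by have := (Finset.mem_Ico.1 hj).2; omega)
    _ ≤ ∑ j ∈ range (D + 1), N.choose j := by
        refine Finset.sum_le_sum_of_subset_of_nonneg (fun j hj => ?_) fun _ _ _ => Nat.zero_le _
        rw [Finset.mem_Ico] at hj
        rw [Finset.mem_range]
        omega

/-! ### The special case (Srinivasan's Lemma 3.2, counting form) -/

/-- A geometric tail: `Σ_{i ∈ [2, K)} y^{i-1} ≤ 2y` for `0 ≤ y ≤ 1/2`. [folklore] -/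
private theorem geom_tail_le {y : ℝ} (hy0 : 0 ≤ y) (hy1 : y ≤ 1 / 2) (K : ℕ) :
    ∑ i ∈ Ico 2 K, y ^ (i - 1) ≤ 2 * y := by
  have h1 : ∀ i ∈ Ico 2 K, y ^ (i - 1) ≤ y * (1 / 2) ^ (i - 2) := by
    intro i hi
    have hi2 : 2 ≤ i := (Finset.mem_Ico.1 hi).1
    calc y ^ (i - 1) = y * y ^ (i - 2) := by
          rw [← pow_succ', show i - 2 + 1 = i - 1 by omega]
      _ ≤ y * (1 / 2) ^ (i - 2) :=
          mul_le_mul_of_nonneg_left (pow_le_pow_left₀ hy0 hy1 _) hy0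
  refine (Finset.sum_le_sum h1).trans ?_
  rw [← Finset.mul_sum, Finset.sum_Ico_eq_sum_range]
  have h2 : ∑ k ∈ range (K - 2), ((1 : ℝ) / 2) ^ (2 + k - 2) ≤ 2 := by
    calc ∑ k ∈ range (K - 2), ((1 : ℝ) / 2) ^ (2 + k - 2)
        = ∑ k ∈ Ico 0 (K - 2), ((1 : ℝ) / 2) ^ k := by
          rw [Finset.range_eq_Ico]
          exact Finset.sum_congr rfl fun k _ => by rw [show 2 + k - 2 = k by omega]
      _ ≤ ((1 : ℝ) / 2) ^ 0 / (1 - 1 / 2) := geom_sum_Ico_le_of_lt_one (by norm_num) (by norm_num)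
      _ = 2 := by norm_num
  calc y * ∑ k ∈ range (K - 2), ((1 : ℝ) / 2) ^ (2 + k - 2) ≤ y * 2 :=
        mul_le_mul_of_nonneg_left h2 hy0
    _ = 2 * y := mul_comm _ _
set_option maxHeartbeats 400000 in -- buildfix (bf3-g25): 160k/180k FAIL, 200k PASS at accept time; line-neutral budget line
/-- **The special case** (Srinivasan 2023, Lemma 3.2, in counting form with our constants): on
`{0,1}^{2m}` let `t = p^ℓ` with `t ≥ 2550`, `9t ≤ 2m`, `20m ≤ t²`; if `Q` has degree `≤ d`, is
non-zero on at most an `e^{-t²/m}` fraction of the layer `m - t` and on at least an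
`e^{-t²/(4m)}` fraction of the middle layer `m`, then `d > t/50`.
Proof as printed: `R = Q · Q₁ · Q₂` with `Q₁` the Lucas polynomial (Claim 3.8) and `Q₂` from the
closure bound (Claim 3.9) vanishes on the Hamming ball of radius `m - 1` and is non-zero, so
`deg R ≥ m` (Fact 3.4). [cite: Srinivasan2023, Lemma 3.2] -/
theorem special_case {p : ℕ} [Fact p.Prime] [CharP F p]
    {m t ℓ d : ℕ} (ht : t = p ^ ℓ) (ht0 : 2550 ≤ t) (htm : 9 * t ≤ 2 * m) (hθ : 20 * m ≤ t ^ 2)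
    {Q : CubeFn F (2 * m)} (hQ : Q ∈ lowDeg F (2 * m) d)
    (hZ : ((((layer (2 * m) (m - t)).filter fun a => Q a ≠ 0).card : ℝ)) ≤
      Real.exp (-((t : ℝ) ^ 2 / m)) * ((2 * m).choose (m - t) : ℝ))
    (hW : Real.exp (-((t : ℝ) ^ 2 / (4 * m))) * ((2 * m).choose m : ℝ) ≤
      (((layer (2 * m) m).filter fun a => Q a ≠ 0).card : ℝ)) :
    t / 50 < d := by
  -- parameters
  set t1 := t / 50 with ht1
  have ht1le : 50 * t1 ≤ t := Nat.mul_div_le t 50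
  have ht1ge : t ≤ 50 * t1 + 49 := by omega
  have ht1pos : 51 ≤ t1 := by omega
  set D := m - t - t1 with hD
  have hmt : t + t1 ≤ m := by omega
  have hm0 : 0 < m := by omega
  set b := t + 2 * t1 with hb
  have hb4 : 4 * b ≤ m := by omega
  -- the sets
  set E0 := (layer (2 * m) (m - t)).filter fun a => Q a ≠ 0 with hE0
  set Low := (univ : Finset (Fin (2 * m) → Bool)).filter fun a => wt a < m - t ∧ wt a % t = m % t
    with hLow
  set E := E0 ∪ Low with hE
  set T := (layer (2 * m) m).filter fun a => Q a ≠ 0 with hT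
  -- real quantities
  set y : ℝ := Real.exp (-((t : ℝ) ^ 2 / m)) with hy
  set w : ℝ := Real.exp (-((t : ℝ) ^ 2 / (4 * m))) with hw
  clear_value t1 D b E0 Low E T y w
  have hmR : (0 : ℝ) < m := by exact_mod_cast hm0
  have htR : (2550 : ℝ) ≤ t := by exact_mod_cast ht0
  have hθR : (20 : ℝ) * m ≤ (t : ℝ) ^ 2 := by exact_mod_cast hθ
  have hy_le : y ≤ 1 / 2 := by
    -- `t²/m ≥ 20`, so `e^{-t²/m} ≤ e^{-1} ≤ 1/2`
    have h20 : (1 : ℝ) ≤ (t : ℝ) ^ 2 / m := by rw [le_div_iff₀ hmR]; linarith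
    have h2 : (2 : ℝ) ≤ Real.exp 1 := by linarith [Real.add_one_le_exp (1 : ℝ)]
    rw [hy]
    calc Real.exp (-((t : ℝ) ^ 2 / m)) ≤ Real.exp (-1) := Real.exp_le_exp.2 (by linarith)
      _ = (Real.exp 1)⁻¹ := Real.exp_neg 1
      _ ≤ 2⁻¹ := inv_anti₀ (by norm_num) h2
      _ = 1 / 2 := by norm_num
  have hy0 : 0 ≤ y := by rw [hy]; exact Real.exp_nonneg _
  have hw0 : 0 ≤ w := by rw [hw]; exact Real.exp_nonneg _
  have hcmt : (0 : ℝ) < ((2 * m).choose (m - t) : ℝ) := by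
    exact_mod_cast Nat.choose_pos (by omega)
  -- (1) |Low| ≤ 2y · C((2 * m), m - t)
  have hLow_sub : Low ⊆ (Ico 2 (m / t + 1)).biUnion fun i => layer (2 * m) (m - t * i) := by
    intro a ha
    rw [hLow, Finset.mem_filter] at ha
    obtain ⟨-, hlt, hmod⟩ := ha
    have hdvd : (m - wt a) % t = 0 := Nat.sub_mod_eq_zero_of_mod_eq hmod.symm
    obtain ⟨i, hi⟩ := Nat.dvd_of_mod_eq_zero hdvd
    have ht0' : 0 < t := by omega
    have hgt : t * 1 < t * i := by rw [mul_one, ← hi]; omega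
    have hi2 : 2 ≤ i := by have := Nat.lt_of_mul_lt_mul_left hgt; omega
    have hle' : t * i ≤ m := by rw [← hi]; omega
    have him : i ≤ m / t := (Nat.le_div_iff_mul_le ht0').2 (by rw [Nat.mul_comm]; exact hle')
    refine Finset.mem_biUnion.2 ⟨i, Finset.mem_Ico.2 ⟨hi2, Nat.lt_succ_of_le him⟩, ?_⟩
    rw [mem_layer_iff, ← hi]
    omega
  have hLow_card : (Low.card : ℝ) ≤ 2 * y * ((2 * m).choose (m - t) : ℝ) := by
    have h1 : (Low.card : ℝ) ≤ ∑ i ∈ Ico 2 (m / t + 1), (((2 * m).choose (m - t * i) : ℕ) : ℝ) := by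
      have := (Finset.card_le_card hLow_sub).trans Finset.card_biUnion_le
      simp only [card_layer] at this
      exact_mod_cast this
    have h2 : ∀ i ∈ Ico 2 (m / t + 1), (((2 * m).choose (m - t * i) : ℕ) : ℝ) ≤
        ((2 * m).choose (m - t) : ℝ) * y ^ (i - 1) := by
      intro i hi
      rw [Finset.mem_Ico] at hi
      have hit : t * i ≤ m := by
        have h1 := Nat.div_mul_le_self m t
        have h2 : t * i ≤ t * (m / t) := Nat.mul_le_mul_left t (by omega)
        rw [Nat.mul_comm t (m / t)] at h2
        exact h2.trans h1
      have hti : t ≤ t * i := Nat.le_mul_of_pos_right t (by omega)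
      have hu := choose_ratio_upper m t t le_rfl (t * i) hti hit
      refine hu.trans (mul_le_mul_of_nonneg_left ?_ (Nat.cast_nonneg _))
      -- `(1 - t/m)^{(i-1)t} ≤ e^{-(t/m)(i-1)t} = y^{i-1}`
      have hx1 : (t : ℝ) / m ≤ 1 := by
        rw [div_le_one hmR]; exact_mod_cast (show t ≤ m by omega)
      refine (one_sub_pow_le_exp hx1 _).trans (le_of_eq ?_)
      rw [hy, ← Real.exp_nat_mul]
      congr 1
      have : ((t * i - t : ℕ) : ℝ) = ((i - 1 : ℕ) : ℝ) * t := by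
        rw [Nat.cast_sub hti, Nat.cast_sub (by omega : 1 ≤ i)]; push_cast; ring
      rw [this]
      ring
    calc (Low.card : ℝ) ≤ ∑ i ∈ Ico 2 (m / t + 1), (((2 * m).choose (m - t * i) : ℕ) : ℝ) := h1
      _ ≤ ∑ i ∈ Ico 2 (m / t + 1), ((2 * m).choose (m - t) : ℝ) * y ^ (i - 1) := Finset.sum_le_sum h2
      _ = ((2 * m).choose (m - t) : ℝ) * ∑ i ∈ Ico 2 (m / t + 1), y ^ (i - 1) := by
          rw [Finset.mul_sum]
      _ ≤ ((2 * m).choose (m - t) : ℝ) * (2 * y) :=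
          mul_le_mul_of_nonneg_left (geom_tail_le hy0 hy_le _) (Nat.cast_nonneg _)
      _ = 2 * y * ((2 * m).choose (m - t) : ℝ) := by ring
  -- (2) |E| ≤ 3y · C((2 * m), m - t)
  have hE_card : (E.card : ℝ) ≤ 3 * y * ((2 * m).choose (m - t) : ℝ) := by
    have h' : (E.card : ℝ) ≤ E0.card + Low.card := by
      rw [hE]; exact_mod_cast Finset.card_union_le E0 Low
    linarith [hZ, hLow_card]
  -- (3) N_D ≥ t1 · C((2 * m), m - t) · w
  have hND : (t1 : ℝ) * (((2 * m).choose (m - t) : ℝ) * w) ≤ (numMonomials (2 * m) D : ℝ) := by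
    have h1 : t1 * (2 * m).choose (m - b) ≤ numMonomials (2 * m) D :=
      mul_choose_le_numMonomials (by omega) (by omega)
    have h1R : (t1 : ℝ) * ((2 * m).choose (m - b) : ℝ) ≤ (numMonomials (2 * m) D : ℝ) := by exact_mod_cast h1
    refine le_trans (mul_le_mul_of_nonneg_left ?_ (Nat.cast_nonneg _)) h1R
    -- `C((2 * m), m-t)·w ≤ C((2 * m), m-t)·(1 - 2b/m)^{2t1} ≤ C((2 * m), m-b)`
    have hl := choose_ratio_lower m t b (by omega) b (by omega) le_rfl
    rw [show b - t = 2 * t1 by omega] at hl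
    refine le_trans (mul_le_mul_of_nonneg_left ?_ (Nat.cast_nonneg _)) hl
    have hx0 : (0 : ℝ) ≤ 2 * (b : ℝ) / m := by positivity
    have hx1 : 2 * (b : ℝ) / m ≤ 1 / 2 := by
      rw [div_le_iff₀ hmR]; have : (4 : ℝ) * b ≤ m := by exact_mod_cast hb4
      linarith
    refine le_trans ?_ (exp_neg_le_one_sub_pow hx0 hx1 (2 * t1))
    rw [hw, Real.exp_le_exp, neg_le_neg_iff]
    -- `2·(2b/m)·(2t1) = 8 b t1/m ≤ t²/(4m)`
    have hbt : (32 : ℝ) * b * t1 ≤ (t : ℝ) ^ 2 := by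
      have : 32 * b * t1 ≤ t ^ 2 := by nlinarith
      exact_mod_cast this
    have hre : 2 * (2 * (b : ℝ) / m) * ((2 * t1 : ℕ) : ℝ) = 8 * b * t1 / m := by
      push_cast; ring
    rw [hre, div_le_div_iff₀ hmR (by positivity)]
    nlinarith
  -- (4) |T| ≥ w · C((2 * m), m) ≥ w · 4^m/(2√m)
  have hm1 : 1 ≤ m := hm0
  have hcb := four_pow_le_sqrt_mul_centralBinom m hm1
  have hsqrt : Real.sqrt m ≤ (t : ℝ) / 4 := by
    have h : (m : ℝ) ≤ ((t : ℝ) / 4) ^ 2 := by nlinarith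
    calc Real.sqrt m ≤ Real.sqrt (((t : ℝ) / 4) ^ 2) := Real.sqrt_le_sqrt h
      _ = (t : ℝ) / 4 := Real.sqrt_sq (by positivity)
  -- (5) `e^{t²/(2m)} ≥ 150`
  have hexp : (150 : ℝ) ≤ Real.exp ((t : ℝ) ^ 2 / (2 * m)) := by
    have h10 : (4 : ℝ) * (5 / 2) ≤ (t : ℝ) ^ 2 / (2 * m) := by
      rw [le_div_iff₀ (by positivity)]; linarith
    calc (150 : ℝ) ≤ ((5 : ℝ) / 2 + 1) ^ 4 := by norm_num
      _ ≤ Real.exp (5 / 2) ^ 4 := pow_le_pow_left₀ (by norm_num) (Real.add_one_le_exp _) 4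
      _ = Real.exp (4 * (5 / 2)) := by rw [← Real.exp_nat_mul]; norm_num
      _ ≤ Real.exp ((t : ℝ) ^ 2 / (2 * m)) := Real.exp_le_exp.2 h10
  -- the key inequality (†'): `2^(2 * m) |E| < N_D |E ∪ T|`
  have key : 2 ^ (2 * m) * E.card < numMonomials (2 * m) D * (E ∪ T).card := by
    have hT_le : (T.card : ℝ) ≤ ((E ∪ T).card : ℝ) := by
      exact_mod_cast Finset.card_le_card Finset.subset_union_right
    have hw2 : w * w = Real.exp (-((t : ℝ) ^ 2 / (2 * m))) := by
      rw [hw, ← Real.exp_add]; congr 1; field_simp; ring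
    have hyw : y = Real.exp (-((t : ℝ) ^ 2 / (2 * m))) * Real.exp (-((t : ℝ) ^ 2 / (2 * m))) := by
      rw [hy, ← Real.exp_add]; congr 1; field_simp; ring
    have hu : Real.exp (-((t : ℝ) ^ 2 / (2 * m))) * Real.exp ((t : ℝ) ^ 2 / (2 * m)) = 1 := by
      rw [← Real.exp_add, neg_add_cancel, Real.exp_zero]
    have hupos : 0 < Real.exp (-((t : ℝ) ^ 2 / (2 * m))) := Real.exp_pos _
    -- main numeric step: `3·y·2√m < t1·w·w`
    have hstep : 3 * y * (2 * Real.sqrt m) < (t1 : ℝ) * (w * w) := by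
      rw [hw2, hyw]
      have ht1R : (t : ℝ) ≤ 50 * t1 + 49 := by exact_mod_cast ht1ge
      have hsq' : 2 * Real.sqrt m ≤ (t : ℝ) / 2 := by linarith
      -- reduce to `6·√m < t1 · e^{t²/2m}`
      have h150 : 3 * (2 * Real.sqrt m) < (t1 : ℝ) * Real.exp ((t : ℝ) ^ 2 / (2 * m)) := by
        calc 3 * (2 * Real.sqrt m) ≤ 3 * ((t : ℝ) / 2) := by linarith
          _ < (t1 : ℝ) * 150 := by nlinarith
          _ ≤ (t1 : ℝ) * Real.exp ((t : ℝ) ^ 2 / (2 * m)) :=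
              mul_le_mul_of_nonneg_left hexp (Nat.cast_nonneg _)
      calc 3 * (Real.exp (-((t : ℝ) ^ 2 / (2 * m))) * Real.exp (-((t : ℝ) ^ 2 / (2 * m))))
            * (2 * Real.sqrt m)
          = (3 * (2 * Real.sqrt m)) * Real.exp (-((t : ℝ) ^ 2 / (2 * m))) *
              Real.exp (-((t : ℝ) ^ 2 / (2 * m))) := by ring
        _ < ((t1 : ℝ) * Real.exp ((t : ℝ) ^ 2 / (2 * m))) * Real.exp (-((t : ℝ) ^ 2 / (2 * m))) *
              Real.exp (-((t : ℝ) ^ 2 / (2 * m))) := by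
            gcongr
        _ = (t1 : ℝ) * (Real.exp (-((t : ℝ) ^ 2 / (2 * m))) * Real.exp ((t : ℝ) ^ 2 / (2 * m))) *
              Real.exp (-((t : ℝ) ^ 2 / (2 * m))) := by ring
        _ = (t1 : ℝ) * Real.exp (-((t : ℝ) ^ 2 / (2 * m))) := by rw [hu]; ring
    -- assemble in `ℝ`
    have hfin : (2 : ℝ) ^ (2 * m) * E.card < (numMonomials (2 * m) D : ℝ) * ((E ∪ T).card : ℝ) := by
      have h4 : (2 : ℝ) ^ (2 * m) = (4 : ℝ) ^ m := by rw [pow_mul]; norm_num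
      rw [h4]
      calc (4 : ℝ) ^ m * E.card ≤ (4 : ℝ) ^ m * (3 * y * ((2 * m).choose (m - t) : ℝ)) :=
            mul_le_mul_of_nonneg_left hE_card (by positivity)
        _ = (3 * y) * (4 : ℝ) ^ m * ((2 * m).choose (m - t) : ℝ) := by ring
        _ ≤ (3 * y) * (2 * Real.sqrt m * ((2 * m).choose m : ℝ)) * ((2 * m).choose (m - t) : ℝ) := by
            gcongr
        _ = (3 * y * (2 * Real.sqrt m)) * (((2 * m).choose m : ℝ) * ((2 * m).choose (m - t) : ℝ)) := by ring
        _ < ((t1 : ℝ) * (w * w)) * (((2 * m).choose m : ℝ) * ((2 * m).choose (m - t) : ℝ)) := by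
            have hpos : (0 : ℝ) < ((2 * m).choose m : ℝ) * ((2 * m).choose (m - t) : ℝ) :=
              mul_pos (by exact_mod_cast Nat.choose_pos (by omega)) hcmt
            exact mul_lt_mul_of_pos_right hstep hpos
        _ = ((t1 : ℝ) * (((2 * m).choose (m - t) : ℝ) * w)) * (w * ((2 * m).choose m : ℝ)) := by ring
        _ ≤ (numMonomials (2 * m) D : ℝ) * (T.card : ℝ) :=
            mul_le_mul hND hW (mul_nonneg hw0 (Nat.cast_nonneg _)) (Nat.cast_nonneg _)
        _ ≤ (numMonomials (2 * m) D : ℝ) * ((E ∪ T).card : ℝ) :=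
            mul_le_mul_of_nonneg_left hT_le (Nat.cast_nonneg _)
    exact_mod_cast hfin
  -- the closure bound gives `Q₂`
  obtain ⟨Q2, hQ2, hQ2E, a0, ha0T, hQ2a0⟩ := exists_mem_lowDeg_vanish_ne_zero (F := F) key
  -- the Lucas polynomial `Q₁`
  have hQ1 := lucasPoly_mem_lowDeg (F := F) (n := (2 * m)) p ℓ m
  rw [← ht] at hQ1
  have hR : Q * lucasPoly F (2 * m) p ℓ m * Q2 ∈ lowDeg F (2 * m) (d + (t - 1) + D) :=
    mul_mem_lowDeg_add (mul_mem_lowDeg_add hQ hQ1) hQ2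
  have ha0 : a0 ∈ layer (2 * m) m ∧ Q a0 ≠ 0 := by simpa [hT] using ha0T
  have hRa0 : (Q * lucasPoly F (2 * m) p ℓ m * Q2) a0 ≠ 0 := by
    rw [Pi.mul_apply, Pi.mul_apply]
    refine mul_ne_zero (mul_ne_zero ha0.2 ?_) hQ2a0
    rw [lucasPoly_ne_zero_iff p, mem_layer_iff.1 ha0.1]
  have hRvan : ∀ a : Fin (2 * m) → Bool, (univ.filter fun i => a i = true).card < m →
      (Q * lucasPoly F (2 * m) p ℓ m * Q2) a = 0 := by
    intro a ha'
    have ha : wt a < m := ha'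
    rw [Pi.mul_apply, Pi.mul_apply]
    by_cases hmod : wt a % t = m % t
    · -- `wt a ≡ m (mod t)` and `wt a < m`: so `wt a ≤ m - t`
      have hdvd : (m - wt a) % t = 0 := Nat.sub_mod_eq_zero_of_mod_eq hmod.symm
      have hle : wt a + t ≤ m := by
        obtain ⟨i, hi⟩ := Nat.dvd_of_mod_eq_zero hdvd
        have hi1 : 1 ≤ i := by
          rcases Nat.eq_zero_or_pos i with h0 | h0
          · rw [h0, mul_zero] at hi; omega
          · exact h0
        have hti : t * 1 ≤ t * i := Nat.mul_le_mul_left t hi1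
        rw [mul_one, ← hi] at hti
        omega
      rcases Nat.lt_or_ge (wt a) (m - t) with hlt | hge
      · -- `a ∈ Low ⊆ E`
        have haLow : a ∈ Low := by
          rw [hLow]; exact Finset.mem_filter.2 ⟨Finset.mem_univ a, hlt, hmod⟩
        have haE : a ∈ E := by rw [hE]; exact Finset.mem_union_right _ haLow
        rw [hQ2E a haE, mul_zero]
      · -- `wt a = m - t`: either `Q a = 0` or `a ∈ E0 ⊆ E`
        have hwt : wt a = m - t := le_antisymm (by omega) hge
        by_cases hQa : Q a = 0
        · rw [hQa, zero_mul, zero_mul]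
        · have haE0 : a ∈ E0 := by
            rw [hE0]; exact Finset.mem_filter.2 ⟨mem_layer_iff.2 hwt, hQa⟩
          have haE : a ∈ E := by rw [hE]; exact Finset.mem_union_left _ haE0
          rw [hQ2E a haE, mul_zero]
    · have h0 : lucasPoly F (2 * m) p ℓ m a = 0 := by
        by_contra hne
        have h' := (lucasPoly_ne_zero_iff p ℓ m a).1 hne
        rw [← ht] at h'
        exact hmod h'
      rw [h0, mul_zero, zero_mul]
  have hdeg := le_of_forall_wt_lt hR hRvan hRa0
  omega

/-! ### The general case (Srinivasan's §3.2) -/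

/-- `n · α = min(k, n - k)`.
[cite: Srinivasan2023, Lemma 3.1 (α = min{k/n, 1 - k/n})] -/
theorem mul_alphaOf {n k : ℕ} (hn : 0 < n) (hk : k ≤ n) :
    (n : ℝ) * alphaOf n k = ((min k (n - k) : ℕ) : ℝ) := by
  unfold alphaOf
  have hnR : (0 : ℝ) < n := by exact_mod_cast hn
  rw [Nat.cast_min, Nat.cast_sub hk, mul_min_of_nonneg _ _ hnR.le]
  congr 1
  · field_simp
  · field_simp

/-- `α(n, n-k) = α(n, k)`.
[cite: Srinivasan2023, Lemma 3.1 (α = min{k/n, 1 - k/n})] -/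
theorem alphaOf_sub {n k : ℕ} (hn : 0 < n) (hk : k ≤ n) : alphaOf n (n - k) = alphaOf n k := by
  unfold alphaOf
  have hnR : (0 : ℝ) < n := by exact_mod_cast hn
  rw [Nat.cast_sub hk, sub_div, div_self hnR.ne', sub_sub_cancel, min_comm]

/-- A polynomial of degree `0` cannot satisfy (1a) and (1b): so `d ≥ 1`.
[cite: Srinivasan2023, Lemma 3.1 (proof, §3.2: the degree bound is trivial for bounded q)] -/
theorem one_le_deg {n k K d : ℕ} (hk : k ≤ n) {P : CubeFn F n} (hP : P ∈ lowDeg F n d)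
    (ha : nzFrac P k ≤ 1 / 1000) (hb : 0 < nzFrac P K) : 1 ≤ d := by
  by_contra hd
  have hd0 : d = 0 := by omega
  subst hd0
  have hconst := eq_const_of_mem_lowDeg_zero hP (fun _ => false)
  by_cases hc : P (fun _ => false) = 0
  · -- `P = 0`: contradicts (1b)
    have hP0 : P = 0 := by rw [hconst, hc, zero_smul]
    have : nzFrac P K = 0 := by
      unfold nzFrac
      rw [Finset.card_eq_zero.2, Nat.cast_zero, zero_div]
      refine Finset.filter_false_of_mem fun u _ => ?_
      rw [hP0]; simp
    linarith
  · -- `P` is a non-zero constant: `nzFrac P k = 1`, contradicts (1a)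
    have hall : ∀ u, P u ≠ 0 := fun u => by
      rw [hconst]; simpa using hc
    have : nzFrac P k = 1 := by
      unfold nzFrac
      rw [Finset.filter_true_of_mem fun u _ => hall u, card_layer,
        div_self (by exact_mod_cast (Nat.choose_pos hk).ne')]
    linarith

/-- `2 ≤ e^x` for `x ≥ 1`. [folklore] -/
private theorem two_le_exp {x : ℝ} (hx : 1 ≤ x) : (2 : ℝ) ≤ Real.exp x := by
  linarith [Real.add_one_le_exp x]

/-- The parameters of the two regimes (Srinivasan's Case 1 / Case 2, with our constants): a
half-dimension `m` of the target subcube and an amplification exponent `r ∈ {1, 35}` such that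
the averaged layer densities meet the hypotheses of `special_case`.
[cite: Srinivasan2023, Lemma 3.1 (proof, §3.2, Cases 1 and 2: choice of the subcube dimension and of r)] -/
theorem exists_params {n k q : ℕ} (hq0 : 3000 < q) (h1 : 100 * q < k) (h2 : k + 100 * q < n)
    {ε₀ ε₁ : ℝ} (hε₀ : 0 ≤ ε₀)
    (ha1 : ε₀ ≤ Real.exp (-(100 * ((q : ℝ) ^ 2 / ((min k (n - k) : ℕ) : ℝ)))))
    (ha2 : ε₀ ≤ 1 / 1000)
    (hb : Real.exp (-((q : ℝ) ^ 2 / ((min k (n - k) : ℕ) : ℝ) / 100)) ≤ ε₁) :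
    ∃ m r : ℕ, 1 ≤ r ∧ r ≤ 35 ∧ q ≤ m ∧ m + q ≤ min k (n - k) ∧ 9 * q ≤ 2 * m ∧
      20 * m ≤ q ^ 2 ∧
      2 * ε₀ ^ r ≤ Real.exp (-((q : ℝ) ^ 2 / m)) * ε₁ ^ r ∧
      2 * Real.exp (-((q : ℝ) ^ 2 / (4 * m))) ≤ ε₁ ^ r := by
  set M := min k (n - k) with hM
  have hM100 : 100 * q < M := by rw [hM]; apply lt_min h1; omega
  have hMR : (0 : ℝ) < M := by exact_mod_cast (show 0 < M by omega)
  have hqR : (3000 : ℝ) < q := by exact_mod_cast hq0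
  set θ₀ : ℝ := (q : ℝ) ^ 2 / M with hθ₀
  have hθ₀pos : 0 < θ₀ := by positivity
  have hε₁ : 0 < ε₁ := lt_of_lt_of_le (Real.exp_pos _) hb
  by_cases hcase : 2 * M ≤ q ^ 2
  · -- Case A: no amplification, `m = M/10`
    refine ⟨M / 10, 1, le_rfl, by norm_num, by omega, by omega, by omega, by omega, ?_, ?_⟩
    · have hθ2 : (2 : ℝ) ≤ θ₀ := by
        rw [hθ₀, le_div_iff₀ hMR]; exact_mod_cast hcase
      have hm12 : (M : ℝ) ≤ 12 * ((M / 10 : ℕ) : ℝ) := by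
        have : M ≤ 12 * (M / 10) := by omega
        exact_mod_cast this
      have hmpos : (0 : ℝ) < ((M / 10 : ℕ) : ℝ) := by
        have : 0 < M / 10 := by omega
        exact_mod_cast this
      rw [pow_one, pow_one]
      -- `2 ε₀ ≤ 2 e^{-100 θ₀} ≤ e^{-12 θ₀} e^{-θ₀/100} ≤ e^{-q²/m} ε₁`
      have hq2m : (q : ℝ) ^ 2 / ((M / 10 : ℕ) : ℝ) ≤ 12 * θ₀ := by
        rw [hθ₀, div_le_iff₀ hmpos]
        calc (q : ℝ) ^ 2 = (q : ℝ) ^ 2 / M * M := by field_simp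
          _ ≤ (q : ℝ) ^ 2 / M * (12 * ((M / 10 : ℕ) : ℝ)) :=
              mul_le_mul_of_nonneg_left hm12 (by positivity)
          _ = 12 * ((q : ℝ) ^ 2 / M) * ((M / 10 : ℕ) : ℝ) := by ring
      have h2 : (2 : ℝ) ≤ Real.exp (100 * θ₀ - 12 * θ₀ - θ₀ / 100) := two_le_exp (by linarith)
      calc 2 * ε₀ ≤ 2 * Real.exp (-(100 * θ₀)) := by linarith
        _ ≤ Real.exp (100 * θ₀ - 12 * θ₀ - θ₀ / 100) * Real.exp (-(100 * θ₀)) :=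
            mul_le_mul_of_nonneg_right h2 (Real.exp_nonneg _)
        _ = Real.exp (-(12 * θ₀)) * Real.exp (-(θ₀ / 100)) := by
            rw [← Real.exp_add, ← Real.exp_add]; congr 1; ring
        _ ≤ Real.exp (-((q : ℝ) ^ 2 / ((M / 10 : ℕ) : ℝ))) * ε₁ := by
            refine mul_le_mul (Real.exp_le_exp.2 (by linarith)) (by rwa [hθ₀] at hb ⊢)
              (Real.exp_nonneg _) (Real.exp_nonneg _)
    · have hθ2 : (2 : ℝ) ≤ θ₀ := by
        rw [hθ₀, le_div_iff₀ hMR]; exact_mod_cast hcase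
      have hm10 : 10 * ((M / 10 : ℕ) : ℝ) ≤ M := by
        have : 10 * (M / 10) ≤ M := Nat.mul_div_le M 10
        exact_mod_cast this
      have hmpos : (0 : ℝ) < ((M / 10 : ℕ) : ℝ) := by
        have : 0 < M / 10 := by omega
        exact_mod_cast this
      rw [pow_one]
      have hq4m : 5 / 2 * θ₀ ≤ (q : ℝ) ^ 2 / (4 * ((M / 10 : ℕ) : ℝ)) := by
        rw [hθ₀, le_div_iff₀ (by positivity)]
        calc 5 / 2 * ((q : ℝ) ^ 2 / M) * (4 * ((M / 10 : ℕ) : ℝ))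
            = (q : ℝ) ^ 2 / M * (10 * ((M / 10 : ℕ) : ℝ)) := by ring
          _ ≤ (q : ℝ) ^ 2 / M * M := mul_le_mul_of_nonneg_left hm10 (by positivity)
          _ = (q : ℝ) ^ 2 := by field_simp
      have h2 : (2 : ℝ) ≤ Real.exp (5 / 2 * θ₀ - θ₀ / 100) := two_le_exp (by linarith)
      calc 2 * Real.exp (-((q : ℝ) ^ 2 / (4 * ((M / 10 : ℕ) : ℝ))))
          ≤ 2 * Real.exp (-(5 / 2 * θ₀)) := by
            have := Real.exp_le_exp.2 (neg_le_neg hq4m); linarith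
        _ ≤ Real.exp (5 / 2 * θ₀ - θ₀ / 100) * Real.exp (-(5 / 2 * θ₀)) :=
            mul_le_mul_of_nonneg_right h2 (Real.exp_nonneg _)
        _ = Real.exp (-((q : ℝ) ^ 2 / M / 100)) := by
            rw [← Real.exp_add]; congr 1; rw [hθ₀]; ring
        _ ≤ ε₁ := hb
  · -- Case B: `35`-fold amplification, `m = q²/200`
    rw [not_le] at hcase
    have hqq : 1000 * q ≤ q ^ 2 := by nlinarith
    have hm1 : 200 * (q ^ 2 / 200) ≤ q ^ 2 := Nat.mul_div_le _ _
    have hm2 : q ^ 2 < 200 * (q ^ 2 / 200) + 200 := by omega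
    refine ⟨q ^ 2 / 200, 35, by norm_num, le_rfl, ?_, ?_, by omega, by omega, ?_, ?_⟩
    · rw [Nat.le_div_iff_mul_le (by norm_num)]; nlinarith
    · -- `m + q ≤ M`: `200 m ≤ q² < 2M` and `200 q < 2 M`
      omega
    · have hθ2 : θ₀ < 2 := by
        rw [hθ₀, div_lt_iff₀ hMR]; exact_mod_cast hcase
      have hmpos : (0 : ℝ) < ((q ^ 2 / 200 : ℕ) : ℝ) := by
        have : 0 < q ^ 2 / 200 := by omega
        exact_mod_cast this
      -- `q²/m ≤ 201`
      have hq2m : (q : ℝ) ^ 2 / ((q ^ 2 / 200 : ℕ) : ℝ) ≤ 201 := by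
        rw [div_le_iff₀ hmpos]
        have : q ^ 2 ≤ 201 * (q ^ 2 / 200) := by omega
        exact_mod_cast this
      -- `ε₁^35 ≥ e^{-7/10}`
      have hε₁35 : Real.exp (-(7 / 10)) ≤ ε₁ ^ 35 := by
        have h1 : Real.exp (-(θ₀ / 100)) ≤ ε₁ := by rwa [hθ₀] at hb ⊢
        calc Real.exp (-(7 / 10)) ≤ Real.exp (-(θ₀ / 100)) ^ 35 := by
              rw [← Real.exp_nat_mul]; exact Real.exp_le_exp.2 (by push_cast; linarith)
          _ ≤ ε₁ ^ 35 := pow_le_pow_left₀ (Real.exp_nonneg _) h1 35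
      -- `ε₀^35 ≤ 10^{-105}`
      have hε₀35 : ε₀ ^ 35 ≤ (1 / 1000) ^ 35 := pow_le_pow_left₀ hε₀ ha2 35
      -- `e^{202} ≤ 3^{202}` and `2 · 3^202 · e^{7/10}… ≤ 1000^35`
      have he3 : Real.exp 1 ≤ 3 := by have := Real.exp_one_lt_d9; linarith
      have hexp202 : Real.exp 202 ≤ (3 : ℝ) ^ 202 := by
        have : Real.exp 202 = Real.exp 1 ^ 202 := by rw [← Real.exp_nat_mul]; norm_num
        rw [this]; exact pow_le_pow_left₀ (Real.exp_nonneg _) he3 202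
      have hnum : (2 : ℝ) * 3 ^ 202 ≤ 1000 ^ 35 := by norm_num
      -- assemble: `2 ε₀^35 ≤ 2·10^{-105} ≤ e^{-201}·e^{-7/10} ≤ e^{-q²/m} ε₁^35`
      have hkey : (2 : ℝ) * (1 / 1000) ^ 35 ≤ Real.exp (-201) * Real.exp (-(7 / 10)) := by
        rw [← Real.exp_add, show (-201 : ℝ) + -(7 / 10) = -(201 + 7 / 10) by ring, Real.exp_neg,
          show ((1 : ℝ) / 1000) ^ 35 = (1000 ^ 35)⁻¹ by rw [one_div, inv_pow]]
        rw [← div_eq_mul_inv, ← one_div, div_le_div_iff₀ (by positivity) (Real.exp_pos _), one_mul]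
        calc 2 * Real.exp (201 + 7 / 10) ≤ 2 * Real.exp 202 := by
              have := Real.exp_le_exp.2 (show (201 : ℝ) + 7 / 10 ≤ 202 by norm_num); linarith
          _ ≤ 2 * 3 ^ 202 := by linarith
          _ ≤ 1000 ^ 35 := hnum
      calc 2 * ε₀ ^ 35 ≤ 2 * (1 / 1000) ^ 35 := by linarith
        _ ≤ Real.exp (-201) * Real.exp (-(7 / 10)) := hkey
        _ ≤ Real.exp (-((q : ℝ) ^ 2 / ((q ^ 2 / 200 : ℕ) : ℝ))) * ε₁ ^ 35 :=
            mul_le_mul (Real.exp_le_exp.2 (by linarith)) hε₁35 (Real.exp_nonneg _)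
              (Real.exp_nonneg _)
    · have hθ2 : θ₀ < 2 := by
        rw [hθ₀, div_lt_iff₀ hMR]; exact_mod_cast hcase
      have hmpos : (0 : ℝ) < ((q ^ 2 / 200 : ℕ) : ℝ) := by
        have : 0 < q ^ 2 / 200 := by omega
        exact_mod_cast this
      have hq4m : (50 : ℝ) ≤ (q : ℝ) ^ 2 / (4 * ((q ^ 2 / 200 : ℕ) : ℝ)) := by
        rw [le_div_iff₀ (by positivity)]
        have : 50 * (4 * (q ^ 2 / 200)) ≤ q ^ 2 := by omega
        exact_mod_cast this
      have hε₁35 : Real.exp (-(7 / 10)) ≤ ε₁ ^ 35 := by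
        have h1 : Real.exp (-(θ₀ / 100)) ≤ ε₁ := by rwa [hθ₀] at hb ⊢
        calc Real.exp (-(7 / 10)) ≤ Real.exp (-(θ₀ / 100)) ^ 35 := by
              rw [← Real.exp_nat_mul]; exact Real.exp_le_exp.2 (by push_cast; linarith)
          _ ≤ ε₁ ^ 35 := pow_le_pow_left₀ (Real.exp_nonneg _) h1 35
      have h2 : (2 : ℝ) ≤ Real.exp (50 - 7 / 10) := two_le_exp (by norm_num)
      calc 2 * Real.exp (-((q : ℝ) ^ 2 / (4 * ((q ^ 2 / 200 : ℕ) : ℝ))))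
          ≤ 2 * Real.exp (-50) := by
            have := Real.exp_le_exp.2 (neg_le_neg hq4m); linarith
        _ ≤ Real.exp (50 - 7 / 10) * Real.exp (-50) :=
            mul_le_mul_of_nonneg_right h2 (Real.exp_nonneg _)
        _ = Real.exp (-(7 / 10)) := by rw [← Real.exp_add]; congr 1; ring
        _ ≤ ε₁ ^ 35 := hε₁35

/-- **Lemma 3.1 for `K = k + q` and `q > 3000`**: restrict–amplify–average (`ampRestrict`,
`sum_nzFrac_ampRestrict`), select a good outcome (`exists_le_and_lt`), and apply the special
case on the centred subcube. [cite: Srinivasan2023, Lemma 3.1 (proof, §3.2)] -/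
theorem main_aux {p : ℕ} [Fact p.Prime] [CharP F p] {n k q d : ℕ} (hq : ∃ j : ℕ, q = p ^ j)
    (hq0 : 3000 < q) (h1 : 100 * q < k) (h2 : k + 100 * q < n) {P : CubeFn F n}
    (hP : P ∈ lowDeg F n d)
    (ha : nzFrac P k ≤ min (Real.exp (-(100 * (q : ℝ) ^ 2 / (n * alphaOf n k)))) (1 / 1000))
    (hb : Real.exp (-((q : ℝ) ^ 2 / (100 * n * alphaOf n k))) ≤ nzFrac P (k + q)) :
    q ≤ 3000 * d := by
  obtain ⟨ℓ, hℓ⟩ := hq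
  have hn : 0 < n := by omega
  have hkn : k ≤ n := by omega
  have hM := mul_alphaOf hn hkn
  -- the hypotheses in terms of `θ₀ = q² / min(k, n-k)`
  have ha1 : nzFrac P k ≤ Real.exp (-(100 * ((q : ℝ) ^ 2 / ((min k (n - k) : ℕ) : ℝ)))) := by
    refine (min_le_left _ _).trans' ha |>.trans (le_of_eq ?_)
    rw [← hM]; congr 1; ring
  have ha2 : nzFrac P k ≤ 1 / 1000 := ha.trans (min_le_right _ _)
  have hb' : Real.exp (-((q : ℝ) ^ 2 / ((min k (n - k) : ℕ) : ℝ) / 100)) ≤ nzFrac P (k + q) := by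
    refine le_trans (le_of_eq ?_) hb
    rw [← hM]; congr 1; ring
  obtain ⟨m, r, hr1, hr35, hqm, hmM, h9, h20, c1, c2⟩ :=
    exists_params hq0 h1 h2 (nzFrac_nonneg P k) ha1 ha2 hb'
  have hε₁ : 0 < nzFrac P (k + q) := lt_of_lt_of_le (Real.exp_pos _) hb
  -- the subcube: `2m` free coordinates, then `r₁ = k + q - m` ones, then zeros
  have hmk : m ≤ k + q := by
    have := min_le_left k (n - k); omega
  have hle : 2 * m + (k + q - m) ≤ n := by
    have := min_le_right k (n - k); omega
  set r₁ := k + q - m with hr₁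
  have hk1 : m - q + r₁ = k := by omega
  have hK1 : m + r₁ = k + q := by omega
  -- averaging over `π⃗ ∈ Perm(n)^r`
  set ι := Fin r → Equiv.Perm (Fin n)
  set cP : ℝ := (Fintype.card (Equiv.Perm (Fin n)) : ℝ) with hcP
  have hcard : (Fintype.card ι : ℝ) = cP ^ r := by
    rw [hcP, Fintype.card_fun, Fintype.card_fin]; push_cast; ring
  have hsum1 := sum_nzFrac_ampRestrict P hle r (show m - q ≤ 2 * m by omega)
  have hsum2 := sum_nzFrac_ampRestrict P hle r (show m ≤ 2 * m by omega)
  rw [hk1] at hsum1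
  rw [hK1] at hsum2
  obtain ⟨πs, hf, hg⟩ := exists_le_and_lt (ι := ι)
    (fun πs => nzFrac (ampRestrict P (2 * m) r₁ πs) (m - q))
    (fun πs => nzFrac (ampRestrict P (2 * m) r₁ πs) m)
    (A := nzFrac P k ^ r) (B := nzFrac P (k + q) ^ r)
    (fun πs => nzFrac_nonneg _ _) (fun πs => nzFrac_le_one _ _)
    (pow_nonneg (nzFrac_nonneg P k) r) (pow_pos hε₁ r)
    (by rw [hsum1, hcard, mul_pow]) (by rw [hsum2, hcard, mul_pow])
  -- the selected polynomial on the subcube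
  set Q := ampRestrict P (2 * m) r₁ πs with hQdef
  have hQ : Q ∈ lowDeg F (2 * m) (r * d) := ampRestrict_mem_lowDeg hP (2 * m) r₁ πs
  have hB : 0 < nzFrac P (k + q) ^ r := pow_pos hε₁ r
  have hcq : (0 : ℝ) < ((2 * m).choose (m - q) : ℝ) := by exact_mod_cast Nat.choose_pos (by omega)
  have hcm : (0 : ℝ) < ((2 * m).choose m : ℝ) := by exact_mod_cast Nat.choose_pos (by omega)
  have hZ : ((((layer (2 * m) (m - q)).filter fun a => Q a ≠ 0).card : ℝ)) ≤
      Real.exp (-((q : ℝ) ^ 2 / m)) * ((2 * m).choose (m - q) : ℝ) := by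
    have hfrac : nzFrac Q (m - q) ≤ Real.exp (-((q : ℝ) ^ 2 / m)) := by
      refine hf.trans ?_
      rw [div_le_iff₀ hB]
      exact c1
    unfold nzFrac at hfrac
    rwa [div_le_iff₀ hcq] at hfrac
  have hW : Real.exp (-((q : ℝ) ^ 2 / (4 * m))) * ((2 * m).choose m : ℝ) ≤
      (((layer (2 * m) m).filter fun a => Q a ≠ 0).card : ℝ) := by
    have hfrac : Real.exp (-((q : ℝ) ^ 2 / (4 * m))) ≤ nzFrac Q m := by
      have : Real.exp (-((q : ℝ) ^ 2 / (4 * m))) ≤ nzFrac P (k + q) ^ r / 2 := by linarith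
      exact this.trans hg.le
    unfold nzFrac at hfrac
    rwa [le_div_iff₀ hcm] at hfrac
  have hdeg := special_case hℓ (by omega) h9 h20 hQ hZ hW
  -- `q/50 < r·d` with `r ≤ 35`
  have : q < 50 * (r * d) + 50 := by omega
  nlinarith

/-- **Srinivasan's robust Hegedűs lemma, proved** (discharge of the named fact, with
`c_H = 1/3000` and `n₀ = 0`). [cite: Srinivasan2023, Lemma 3.1] -/
theorem Srinivasan2023_robustHegedus_holds : Srinivasan2023_robustHegedus := by
  refine ⟨1 / 3000, by norm_num, 0, ?_⟩
  intro p _ F _ _ _ n _ k q d hq h1 h2 P hP ha hb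
  have hn : 0 < n := by omega
  have hkn : k ≤ n := by omega
  -- `d ≥ 1`
  have hd1 : 1 ≤ d := by
    rcases hb with hb | hb
    · exact one_le_deg hkn hP (ha.trans (min_le_right _ _)) (lt_of_lt_of_le (Real.exp_pos _) hb)
    · exact one_le_deg hkn hP (ha.trans (min_le_right _ _)) (lt_of_lt_of_le (Real.exp_pos _) hb)
  -- small `q` is free
  by_cases hq0 : q ≤ 3000
  · have : (q : ℝ) ≤ 3000 := by exact_mod_cast hq0
    have : (1 : ℝ) ≤ d := by exact_mod_cast hd1
    nlinarith
  rw [not_le] at hq0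
  suffices h : q ≤ 3000 * d by
    have : (q : ℝ) ≤ 3000 * d := by exact_mod_cast h
    linarith
  rcases hb with hb | hb
  · exact main_aux hq hq0 h1 h2 hP ha hb
  · -- `K = k - q`: negate all inputs
    have h1' : 100 * q < n - k := by omega
    have h2' : (n - k) + 100 * q < n := by omega
    have hα : alphaOf n (n - k) = alphaOf n k := alphaOf_sub hn hkn
    refine main_aux (P := cpl P) hq hq0 h1' h2' (cpl_mem_lowDeg hP) ?_ ?_
    · rw [hα, nzFrac_cpl P (by omega), Nat.sub_sub_self hkn]
      exact ha
    · rw [hα, nzFrac_cpl P (by omega), show n - (n - k + q) = k - q by omega]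
      exact hb

end Proof

/-- **The case `F = 𝔽₂`, unconditionally**: p1's `RobustHegedusF2` shape of the QuantumAdvantage
cell qa-qnc0, now a theorem (`robustHegedus_F2` fed with `Srinivasan2023_robustHegedus_holds`).
[cite: Srinivasan2023, Lemma 3.1 (p = 2)] -/
theorem robustHegedus_F2_holds :
    ∃ cH : ℝ, 0 < cH ∧ ∃ n₀ : ℕ, ∀ n : ℕ, n₀ ≤ n → ∀ k q d : ℕ, (∃ j : ℕ, q = 2 ^ j) →
      100 * q < k → k + 100 * q < n →
      ∀ P : CubeFn (ZMod 2) n, P ∈ lowDeg (ZMod 2) n d →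
        nzFrac P k ≤ min (Real.exp (-(100 * (q : ℝ) ^ 2 / (n * alphaOf n k)))) (1 / 1000) →
        (Real.exp (-((q : ℝ) ^ 2 / (100 * n * alphaOf n k))) ≤ nzFrac P (k + q) ∨
          Real.exp (-((q : ℝ) ^ 2 / (100 * n * alphaOf n k))) ≤ nzFrac P (k - q)) →
        cH * q ≤ d :=
  robustHegedus_F2 Srinivasan2023_robustHegedus_holds

/-- Contrapositive reading, unconditionally: a polynomial of degree `d < c_H·q` over a field of
characteristic `p` (`q` a power of `p`) that is exponentially rarely non-zero on layer `k` is
non-zero on less than an `e^{-q²/(100nα)}` fraction of BOTH layers `k ± q`.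
[cite: Srinivasan2023, Lemma 3.1] -/
theorem nzFrac_lt_of_lowDeg :
    ∃ cH : ℝ, 0 < cH ∧ ∃ n₀ : ℕ,
      ∀ (p : ℕ) [Fact p.Prime] (F : Type) [Field F] [CharP F p] [DecidableEq F] (n : ℕ), n₀ ≤ n →
        ∀ k q d : ℕ, (∃ j : ℕ, q = p ^ j) → 100 * q < k → k + 100 * q < n → (d : ℝ) < cH * q →
          ∀ P : CubeFn F n, P ∈ lowDeg F n d →
            nzFrac P k ≤ min (Real.exp (-(100 * (q : ℝ) ^ 2 / (n * alphaOf n k)))) (1 / 1000) →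
            nzFrac P (k + q) < Real.exp (-((q : ℝ) ^ 2 / (100 * n * alphaOf n k))) ∧
              nzFrac P (k - q) < Real.exp (-((q : ℝ) ^ 2 / (100 * n * alphaOf n k))) :=
  Srinivasan2023_robustHegedus.nzFrac_lt Srinivasan2023_robustHegedus_holds

end Hegedus

end Literature.Computability.MetaComplexity
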